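import Literature.NumberTheory.LFunctions.SiegelZeroExceptionalPrimesProofs
import Literature.NumberTheory.LFunctions.DeuringZeroSpacingPhenomenon
import Literature.NumberTheory.LFunctions.MertensElementary
import Mathlib.Analysis.SpecialFunctions.Pow.Asymptotics
import HarnessLib

/-!
# Lacunarity of `1 ⋆ ψ` beyond `D²` and sparsity of the split primes, in `L(1, ψ)`-currency
# (Bui–Pratt–Zaharescu 2024, §3: Lemma 3.5, the first display of the proof of Lemma 3.7,
# Lemma 3.7, Lemma 3.8 (i))

Topic `Literature/NumberTheory/LFunctions` (namespace `Literature.NumberTheory.LFunctions`, the paper's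
objects in the sub-namespace `BPZ2024` as in `AnalyticRanksLandauSiegel.lean`). Written for the cell
`landau-siegel` (rung F-S3), family B-fam, E(d)-row famE-04c «E-fam-splitprimes» (bookkeeping of the
sparse set of primes `p` with `ψ(p) = +1` when `L(1, ψ)` is small, "BPZ-type"). THREE of the four
statements are PROVED here from tree theorems; ONE (Lemma 3.7, whose engine is Friedlander–Iwaniec's
Proposition 3.1 of *Exceptional discriminants are the sum of a square and a prime*) is a named fact.

## What the source prints (held text `paper:arxiv-2102.03087`, read 2026-08-26)

H. M. Bui, K. Pratt, A. Zaharescu, *Analytic ranks of automorphic `L`-functions and Landau–Siegel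
zeros*, J. London Math. Soc. (2) 109 (2024) e12834 = arXiv:2102.03087 [BuiPrattZaharescu2023].
Standing conventions of §2 (p. 3, l. 53–58): "Throughout we let `D` be large and let `ψ` be a real,
odd, primitive Dirichlet character modulo `D`. … We assume throughout that `L(1,ψ)(log D) = o(1)`,
where `o(1)` denotes a quantity that tends to zero as `D → ∞`." `(1 ⋆ ψ)(n) = ∑_{d ∣ n} ψ(d)`.

> **Lemma 3.5** (p. 8, l. 30–43). For any `x ≥ D²` we have
> `∑_{D² < n ≤ x} (1⋆ψ)(n)/n ≤ L(1,ψ)(log x)`.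
> *Proof.* Apply [14; (22.109)] twice and subtract the expressions. This gives
> `∑_{D² < n ≤ x} (1⋆ψ)(n)/n ≤ L(1,ψ)(log x) − L(1,ψ)(log D²) + O(D^{−3/4}(log D)) ≤ L(1,ψ)(log x)`,
> since `L(1,ψ) ≫ D^{−1/2}`. □

([14; (22.109)] = Iwaniec–Kowalski (22.109):
`∑_{n ≤ x} (1⋆ψ)(n)/n = L(1,ψ)(log x + γ) + L'(1,ψ) + O(x^{−1/2} D^{1/4} log x)`, as displayed in the
authors' companion paper, Math. Ann. 380 (2021) = arXiv:2012.04392, §2, whose next display is exactly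
Lemma 3.5 [BuiPrattZaharescu2021].)

> **Lemma 3.7** (p. 10, l. 5–11). For any `x ≥ D` we have
> `∑_{p ≤ x, ψ(p)=1} (log p)/p ≪ (log log(1/L(1,ψ) log D) / log(1/L(1,ψ) log D)) log D + L(1,ψ)^{1/2}(log x)^{3/2}`.
> *Proof* (first display, p. 10, l. 12–24). "We use lacunarity to reduce the range of `p` to `p ≤ D`.
> Since our basic lacunarity estimate Lemma 3.5 does not quite apply in this shorter range, we use a
> crude "tensor power" trick. We have
> `(∑_{D < p ≤ x, ψ(p)=1} 1/p)² ≤ ∑_{D < p₁,p₂ ≤ x} (1+ψ(p₁))(1+ψ(p₂))/(p₁p₂) ≤ ∑_{p > √D} 4/p² + ∑_{D² < n ≤ x²} (1⋆ψ)(n)/n ≪ D^{−1/2}(log D)^{−1} + L(1,ψ)(log x) ≪ L(1,ψ)(log x)`,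
> where in the last inequality we have used the lower bound `L(1,ψ) ≫ D^{−1/2}`." [The rest of the
> proof, for `p ≤ D`, splits at `D^κ`, `κ = 4 log log(1/L(1,ψ) log D)/log(1/L(1,ψ) log D)`, "and
> observe that we may assume `κ < 1/20`"; the range `D^κ < p ≤ D` uses "Proposition 3.1 of [10]",
> Friedlander–Iwaniec, *Exceptional discriminants are the sum of a square and a prime*:
> `∑_{D^κ < p ≤ D, ψ(p)=1} (log p)/p ≪ (log D)∑_{D^κ<p≤D}(1⋆ψ)(p)/p ≪ κ^{−1}(L(1,ψ) log D)^{κ/2}(log D)`.]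

> **Lemma 3.8** (p. 11, l. 2–8), first half. `L'(1,ψ) = ∑_{n ≤ D²} (1⋆ψ)(n)/n + O(L(1,ψ)(log D))`.
> *Proof.* "[14; (22.109)] and the lower bound `L(1,ψ) ≫ D^{−1/2}`."

(The second half of Lemma 3.8, `L''(1,ψ) = −2γL'(1,ψ) − 2∑_{n ≤ D²}(1⋆ψ)(n)(log n)/n + O(L(1,ψ)(log D)²)`,
needs the second-order hyperbola expansion [14; Exercise 2 p. 527], not in the tree — index-only.
Lemma 3.6 (divisor-twisted lacunarity, `∑_{D⁸<n≤T^B}(1⋆ψ)(n)τ(n)^k/n ≪ L(1,ψ)(log D)^{(…)+ε} + (log D)^{−A}`)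
is index-only: the exponent of `log D` is unreadable in the held text extraction ("`2k+1+1+ε`"),
and no E(d) row consumes it.)

## What is proved here, and from what

Let `ψ` be a PRIMITIVE QUADRATIC character mod `D` (both parities: the printed `ψ` is odd; the
floor `L(1,ψ) ≫ D^{−1/2}` holds for even real `ψ` as well), `λ = RealChar.charDivisorSum ψ`
(`λ(n) = ∑_{d∣n} Re ψ(d) = (1⋆ψ)(n)`, the real form of Mathlib's `ψ.zetaMul`), `L(1,ψ) = ‖ψ.LFunction 1‖`
(`= Re L(1,ψ) > 0`, `Siegel.LFunction_one_re_eq_norm`).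

* `BPZ2024.meanValue_sub_le` — the tree's hyperbola-method mean value
  (`ZetaMulHarmonic.abs_sum_zetaMul_re_div_sub_le`, = [14; (22.109)] / MV Exercise 11.2.3(g)) with
  the Pólya–Vinogradov window bound `W = √D(1 + log D)` (`CharacterTails.norm_window_le_polyaVinogradov`)
  and the cut `y = ⌊N/⌊√D⌋⌋`, uniformly for `N ≥ D²`:
  `|∑_{n ≤ N} λ(n)/n − (L'(1,ψ) + (log N + γ)L(1,ψ))| ≤ ε(D) := 3(1 + log D)(1 + 2 log D)/D + 4/√D`.
* `BPZ2024.sum_Ioc_charDivisorSum_div_le_explicit` — for every `D ≥ 4` and real `x ≥ D²`: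
  `∑_{D² < n ≤ x} λ(n)/n ≤ L(1,ψ)(log x − 2 log D) + 2ε(D)` (no largeness needed).
* `BPZ2024.LacunarityThreshold D` — the explicit numeric side condition
  `6(1 + log D)(1 + 2 log D)/√D + 8 ≤ 1.38 log D` ("`D` large": `2ε(D) ≤ 2·(0.69/√D)·log D ≤ 2L(1,ψ) log D`
  by the class-number floor `√D‖L(1,ψ)‖ ≥ min(2π/9, 3/4) > 0.69` of the tree,
  `sqrt_mul_norm_LFunction_one_ge_of_odd/_of_even`); `BPZ2024.eventually_lacunarityThreshold`:
  it holds for all `D ≥ D₀` (PROVED, `(1 + log D)² D^{−1/2} → 0`).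
* `buiPrattZaharescu2024_lemma35` — **Lemma 3.5 as printed**, for every `D` satisfying the threshold:
  `x ≥ D² ⟹ ∑_{D² < n ≤ x} λ(n)/n ≤ L(1,ψ) log x`; `…_lemma35_eventually` — the `∃ D₀ ∀ D ≥ D₀` form.
* `BPZ2024.sq_sum_inv_splitPrimes_le` — **the first display of the proof of Lemma 3.7**, explicit:
  for `x ≥ D` (threshold `D`), `(∑_{D < p ≤ x, ψ(p)=1} 1/p)² ≤ L(1,ψ) log x + 1/D`
  (diagonal `∑_{p>D} 1/p² ≤ 1/D`; off-diagonal: `p₁ ≠ p₂` split ⟹ `λ(p₁p₂) = 4`, the ordered pairs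
  with `p₁ < p₂` (resp. `>`) inject into `D² < n ≤ x²`, and Lemma 3.5 at `x²`); and the printed shape
  `BPZ2024.sq_sum_inv_splitPrimes_le'`: `(∑ …)² ≤ 2 L(1,ψ) log x`.
* `buiPrattZaharescu2024_lemma38_deriv` — **Lemma 3.8 (i)** with an explicit constant:
  `|L'(1,ψ) − ∑_{n ≤ D²} λ(n)/n| ≤ 4 L(1,ψ) log D` (threshold `D`; `L'(1,ψ)` is real,
  `ExceptionalZero.deriv_LFunction_ofReal_im_eq_zero`-type fact not needed: we state it for `Re L'`).
* `buiPrattZaharescu2024_lemma37` — **Lemma 3.7**, NAMED FACT (`def … : Prop`, D-0014), with the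
  standing assumptions of §2 made explicit (`D ≥ D₀`, `ψ` real odd primitive, `L(1,ψ) log D ≤ c₀`).

What print does NOT give (recorded for the consumer): no bound `o(1)` for the `1/p`-mass of the split
primes `p ≤ D^κ` with `κ → 0` — Lemma 3.7 controls `∑_{p ≤ D, ψ(p)=1} (log p)/p = o(log D)` only, i.e.
`∑_{D^κ < p ≤ D, ψ(p)=1} 1/p ≪ κ^{−1}·o(1)`; small split primes are not excluded by `L(1,ψ)` being
`(log D)^{−A}`-small (a split `p` changes `L(1,ψ)` by a bounded factor only).

## References

* [BuiPrattZaharescu2023] H. M. Bui, K. Pratt, A. Zaharescu, *Analytic ranks of automorphic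
  L-functions and Landau–Siegel zeros*, J. London Math. Soc. (2) 109 (2024) e12834; arXiv:2102.03087,
  §3: Lemma 3.5 (p. 8), Lemma 3.7 and its proof (p. 10), Lemma 3.8 (p. 11).
* [BuiPrattZaharescu2021] H. M. Bui, K. Pratt, A. Zaharescu, *Exceptional
  characters and nonvanishing of Dirichlet L-functions*, Math. Ann. 380 (2021) 593–642;
  arXiv:2012.04392, §2 (the same two displays).
* [IwaniecKowalski2004] H. Iwaniec, E. Kowalski, *Analytic Number Theory*, AMS Coll. Publ. 53, (22.109).
* [MontgomeryVaughan2007] H. L. Montgomery, R. C. Vaughan, *Multiplicative Number Theory I*, §11.2.1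
  Exercise 3(g); Theorem 9.13 / §4.3 (class number formula floor).

«The programme SEARCHES and TYPES; no claim about Landau–Siegel zeros, Theorems 1–2 of
arXiv:2211.02515 or a repaired Margin232 until a kernel theorem says so.»
-/

noncomputable section

open Finset Filter Topology
open Literature.NumberTheory.LFunctions.DirichletAbel

namespace Literature.NumberTheory.LFunctions

namespace BPZ2024

variable {D : ℕ}

/-! ### Elementary inequalities -/

/-- `(1 + log t)/t` is non-increasing on `[1, ∞)`: for `1 ≤ M ≤ N`,
`(1 + log N)/N ≤ (1 + log M)/M`. [folklore] -/
private theorem one_add_log_div_antitone {M N : ℝ} (hM : 1 ≤ M) (hMN : M ≤ N) :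
    (1 + Real.log N) / N ≤ (1 + Real.log M) / M := by
  have hM0 : 0 < M := by linarith
  have hN0 : 0 < N := by linarith
  have hlogM : 0 ≤ Real.log M := Real.log_nonneg hM
  -- `log N − log M = log (N/M) ≤ N/M − 1`
  have h1 : Real.log N - Real.log M ≤ N / M - 1 := by
    rw [← Real.log_div hN0.ne' hM0.ne']
    exact Real.log_le_sub_one_of_pos (by positivity)
  rw [div_le_div_iff₀ hN0 hM0]
  -- `M(1 + log N) ≤ M log M + N ≤ N(1 + log M)`
  have h2 : M * (1 + Real.log N) ≤ M * Real.log M + N := by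
    have : M * (Real.log N - Real.log M) ≤ M * (N / M - 1) := mul_le_mul_of_nonneg_left h1 hM0.le
    have h3 : M * (N / M - 1) = N - M := by field_simp
    linarith
  nlinarith

/-- `∑_{D < a ≤ M} 1/a² ≤ 1/D − 1/M ≤ 1/D` (telescoping `1/a² ≤ 1/(a−1) − 1/a`), for `1 ≤ D ≤ M`. [folklore] -/
private theorem sum_Ioc_inv_sq_le {D M : ℕ} (hD : 1 ≤ D) (hDM : D ≤ M) :
    ∑ a ∈ Ioc D M, (1 : ℝ) / ((a : ℝ) ^ 2) ≤ 1 / D - 1 / M := by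
  induction M, hDM using Nat.le_induction with
  | base => simp
  | succ M hDM ih =>
    rw [Finset.sum_Ioc_succ_top (by omega), Nat.cast_succ]
    have hM0 : (0 : ℝ) < M := by exact_mod_cast (show 0 < M by omega)
    have hstep : (1 : ℝ) / (((M : ℝ) + 1) ^ 2) ≤ 1 / M - 1 / ((M : ℝ) + 1) := by
      rw [div_sub_div _ _ hM0.ne' (by positivity), div_le_div_iff₀ (by positivity) (by positivity)]
      nlinarith
    linarith

/-- `⌊√D⌋` against `√D`: `⌊√D⌋ ≤ √D` and, for `D ≥ 4`, `√D/2 ≤ ⌊√D⌋`. [folklore] -/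
private theorem natSqrt_le_sqrt (D : ℕ) : (Nat.sqrt D : ℝ) ≤ Real.sqrt D := by
  rw [Real.le_sqrt (Nat.cast_nonneg _) (Nat.cast_nonneg _)]
  exact_mod_cast Nat.sqrt_le' D

/-- For `D ≥ 4`, `√D/2 ≤ ⌊√D⌋` (indeed `⌊√D⌋ > √D − 1 ≥ √D/2`). [folklore] -/
private theorem sqrt_div_two_le_natSqrt {D : ℕ} (hD : 4 ≤ D) : Real.sqrt D / 2 ≤ (Nat.sqrt D : ℝ) := by
  have h1 : Real.sqrt D < (Nat.sqrt D : ℝ) + 1 := by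
    rw [Real.sqrt_lt' (by positivity)]
    exact_mod_cast Nat.lt_succ_sqrt' D
  have h2 : (2 : ℝ) ≤ Real.sqrt D := by
    rw [show (2 : ℝ) = Real.sqrt 4 by rw [show (4 : ℝ) = 2 ^ 2 by norm_num, Real.sqrt_sq (by norm_num)]]
    exact Real.sqrt_le_sqrt (by exact_mod_cast hD)
  linarith

/-! ### The character: primitive quadratic mod `D` -/

/-- A primitive character of conductor `D ≥ 2` is non-trivial. [folklore] -/
private theorem ne_one_of_isPrimitive [NeZero D] {ψ : DirichletCharacter ℂ D} (hprim : ψ.IsPrimitive)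
    (hD : 2 ≤ D) : ψ ≠ 1 := by
  rintro rfl
  rw [DirichletCharacter.isPrimitive_def, DirichletCharacter.conductor_one] at hprim
  omega

/-- **The class-number floor**, both parities: `0.69/√D ≤ L(1,ψ)` for every primitive quadratic `ψ`
mod `D ≥ 3` (tree: `√D‖L(1,ψ)‖ ≥ 2π/9` (odd), `≥ 3/4` (even); this is the "`L(1,ψ) ≫ D^{−1/2}`" of the
printed proofs). [cite: MontgomeryVaughan2007, Theorem 9.13 / §4.3] -/
theorem norm_LFunction_one_ge [NeZero D] {ψ : DirichletCharacter ℂ D} (hprim : ψ.IsPrimitive)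
    (hquad : ψ.IsQuadratic) (hD : 3 ≤ D) : (69 / 100) / Real.sqrt D ≤ ‖ψ.LFunction 1‖ := by
  have hD0 : (0 : ℝ) < D := by exact_mod_cast (show 0 < D by omega)
  have hsq : 0 < Real.sqrt D := Real.sqrt_pos.mpr hD0
  rw [div_le_iff₀ hsq, mul_comm]
  rcases ψ.even_or_odd with heven | hodd
  · have h := sqrt_mul_norm_LFunction_one_ge_of_even (by omega) hprim hquad heven
    linarith
  · have h := sqrt_mul_norm_LFunction_one_ge_of_odd hprim hquad hodd
    have hpi : 3.14 < Real.pi := Real.pi_gt_d2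
    nlinarith

/-! ### The mean value `∑_{n ≤ N} λ(n)/n` uniformly for `N ≥ D²` -/

/-- The error quantity `ε(D) = 3(1 + log D)(1 + 2 log D)/D + 4/√D` of the mean value below (an explicit
form of the printed `O(D^{−3/4}(log D))`). [cite: BuiPrattZaharescu2023, §3 proof of Lemma 3.5] -/
def meanValueErr (D : ℕ) : ℝ :=
  3 * (1 + Real.log D) * (1 + 2 * Real.log D) / D + 4 / Real.sqrt D

/-- `ε(D) ≥ 0`. [cite: BuiPrattZaharescu2023, §3 proof of Lemma 3.5 (the `O(D^{−3/4} log D)` term)] -/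
theorem meanValueErr_nonneg (D : ℕ) : 0 ≤ meanValueErr D := by
  have h1 : 0 ≤ Real.log D := Real.log_natCast_nonneg D
  unfold meanValueErr
  positivity

/-- **The mean value of `λ(n)/n`, uniformly for `N ≥ D²`** (tree: MV Exercise 11.2.3(g) = IK (22.109),
`ZetaMulHarmonic.abs_sum_zetaMul_re_div_sub_le`, with the Pólya–Vinogradov window bound
`W = √D(1 + log D)` and the cut `y = ⌊N/⌊√D⌋⌋`): for `ψ` primitive quadratic mod `D ≥ 4` and every
natural `N ≥ D²`,
`|∑_{n ≤ N} λ(n)/n − (L'(1,ψ) + (log N + γ) L(1,ψ))| ≤ ε(D)`.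
[cite: BuiPrattZaharescu2023, §3 proof of Lemma 3.5 ("Apply [14; (22.109)]")]
[cite: MontgomeryVaughan2007, §11.2.1 Exercise 3(g)] -/
theorem meanValue_sub_le [NeZero D] {ψ : DirichletCharacter ℂ D} (hprim : ψ.IsPrimitive)
    (hquad : ψ.IsQuadratic) (hD : 4 ≤ D) {N : ℕ} (hN : D ^ 2 ≤ N) :
    |∑ n ∈ Icc 1 N, RealChar.charDivisorSum ψ n / n -
        ((deriv ψ.LFunction 1).re +
          (Real.log N + Real.eulerMascheroniConstant) * ‖ψ.LFunction 1‖)| ≤ meanValueErr D := by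
  have hsq1 : ψ ^ 2 = 1 := hquad.sq_eq_one
  have hψ1 : ψ ≠ 1 := ne_one_of_isPrimitive hprim (by omega)
  -- the window bound (Pólya–Vinogradov)
  set W : ℝ := Real.sqrt D * (1 + Real.log D) with hW
  have hWin : ∀ N' n : ℕ, ‖∑ k ∈ Ioc N' n, ψ (k : ZMod D)‖ ≤ W :=
    fun N' n => CharacterTails.norm_window_le_polyaVinogradov ψ hprim (by omega) N' n
  -- the cut `y = ⌊N/m⌋`, `m = ⌊√D⌋`
  set m : ℕ := Nat.sqrt D with hm
  have hm1 : 1 ≤ m := Nat.le_sqrt.mpr (by omega)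
  have hmD : m ≤ D := Nat.sqrt_le_self D
  have hD2 : D ≤ D ^ 2 := by nlinarith
  have hN2m : 2 * m ≤ N := by nlinarith
  have hmpos : 0 < m := lt_of_lt_of_le Nat.zero_lt_one hm1
  set y : ℕ := N / m with hy
  have hy2 : 2 ≤ y := (Nat.le_div_iff_mul_le hmpos).mpr hN2m
  have hyN : y ≤ N := Nat.div_le_self N m
  have h := ZetaMulHarmonic.abs_sum_zetaMul_re_div_sub_le ψ hψ1 hsq1 hWin hy2 hyN
  -- rewrite `(ψ.zetaMul n).re = λ(n)` and `Re L(1,ψ) = ‖L(1,ψ)‖`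
  have hsum : ∑ n ∈ Icc 1 N, (ψ.zetaMul n).re / n =
      ∑ n ∈ Icc 1 N, RealChar.charDivisorSum ψ n / n :=
    Finset.sum_congr rfl fun n _ => by rw [SiegelZero.zetaMul_re_eq_charDivisorSum ψ hsq1 n]
  rw [hsum, Siegel.LFunction_one_re_eq_norm ψ hψ1 hsq1] at h
  refine h.trans ?_
  -- numeric facts
  have hD0 : (0 : ℝ) < D := by exact_mod_cast (show 0 < D by omega)
  have hDsq : Real.sqrt D ^ 2 = D := Real.sq_sqrt hD0.le
  have hsqpos : 0 < Real.sqrt D := Real.sqrt_pos.mpr hD0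
  have hm0 : (0 : ℝ) < m := by exact_mod_cast (show 0 < m by omega)
  have hmle : (m : ℝ) ≤ Real.sqrt D := natSqrt_le_sqrt D
  have hmge : Real.sqrt D / 2 ≤ (m : ℝ) := sqrt_div_two_le_natSqrt hD
  have hN1 : (1 : ℝ) ≤ N := by exact_mod_cast (le_trans (by nlinarith) hN : 1 ≤ N)
  have hN0 : (0 : ℝ) < N := by linarith
  have hDN : ((D : ℝ) ^ 2) ≤ N := by exact_mod_cast hN
  have hlogD : 0 ≤ Real.log D := Real.log_natCast_nonneg D
  have hlogN : 0 ≤ Real.log N := Real.log_nonneg hN1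
  have hW0 : 0 ≤ W := by rw [hW]; positivity
  -- (i) `y + 1 ≥ N/m`
  have hy1 : (N : ℝ) / m ≤ (y : ℝ) + 1 := by
    rw [div_le_iff₀ hm0]
    have h' : N < y * m + m := Nat.lt_div_mul_add hmpos
    have h'' : (N : ℝ) < (y : ℝ) * m + m := by exact_mod_cast h'
    nlinarith
  -- (ii) the first error term
  have e1 : 3 * W * (1 + Real.log N) / ((y : ℝ) + 1) ≤
      3 * (1 + Real.log D) * (1 + 2 * Real.log D) / D := by
    have hstep1 : 3 * W * (1 + Real.log N) / ((y : ℝ) + 1) ≤ 3 * W * (1 + Real.log N) / ((N : ℝ) / m) :=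
      div_le_div_of_nonneg_left (by positivity) (by positivity) hy1
    refine hstep1.trans ?_
    rw [div_div_eq_mul_div]
    -- `(1 + log N)/N ≤ (1 + 2 log D)/D²`
    have hmono : (1 + Real.log N) / N ≤ (1 + 2 * Real.log D) / (D : ℝ) ^ 2 := by
      have hD1 : (1 : ℝ) ≤ (D : ℝ) ^ 2 := by
        have h4 : (4 : ℝ) ≤ D := by exact_mod_cast hD
        nlinarith
      have h' := one_add_log_div_antitone (M := (D : ℝ) ^ 2) (N := N) hD1 hDN
      rwa [Real.log_pow, Nat.cast_ofNat] at h'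
    calc 3 * W * (1 + Real.log N) * m / N
        = 3 * W * m * ((1 + Real.log N) / N) := by ring
      _ ≤ 3 * W * Real.sqrt D * ((1 + 2 * Real.log D) / (D : ℝ) ^ 2) := by
          gcongr
      _ = 3 * (Real.sqrt D ^ 2) * (1 + Real.log D) * (1 + 2 * Real.log D) / (D : ℝ) ^ 2 := by
          rw [hW]; ring
      _ = 3 * (1 + Real.log D) * (1 + 2 * Real.log D) / D := by
          rw [hDsq]; field_simp
  -- (iii) the second error term
  have e2 : 2 * (y : ℝ) / N ≤ 4 / Real.sqrt D := by
    have hyle : (y : ℝ) ≤ N / m := by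
      rw [le_div_iff₀ hm0]; exact_mod_cast Nat.div_mul_le_self N m
    calc 2 * (y : ℝ) / N ≤ 2 * ((N : ℝ) / m) / N := by gcongr
      _ = 2 / m := by field_simp
      _ ≤ 2 / (Real.sqrt D / 2) := div_le_div_of_nonneg_left (by norm_num) (by positivity) hmge
      _ = 4 / Real.sqrt D := by rw [div_div_eq_mul_div]; norm_num
  unfold meanValueErr
  linarith

/-! ### Lemma 3.5: explicit form, threshold, printed form -/

/-- `Icc 1 N` splits at `M ≤ N` into `Icc 1 M` and `Ioc M N`. [folklore] -/
private theorem sum_Icc_one_eq_add {N M : ℕ} (hMN : M ≤ N) (f : ℕ → ℝ) :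
    ∑ n ∈ Icc 1 N, f n = ∑ n ∈ Icc 1 M, f n + ∑ n ∈ Ioc M N, f n := by
  have hI : ∀ K : ℕ, Finset.Icc 1 K = Finset.Ioc 0 K := fun K => by
    simpa using Finset.Icc_add_one_left_eq_Ioc 0 K
  rw [hI, hI, ← Finset.sum_Ioc_consecutive f (Nat.zero_le M) hMN]

/-- **Lemma 3.5, explicit form (no largeness)**: for `ψ` primitive quadratic mod `D ≥ 4` and real
`x ≥ D²`, `∑_{D² < n ≤ x} λ(n)/n ≤ L(1,ψ)(log x − 2 log D) + 2ε(D)`.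
[cite: BuiPrattZaharescu2023, §3 Lemma 3.5 (proof, first display)] -/
theorem sum_Ioc_charDivisorSum_div_le_explicit [NeZero D] {ψ : DirichletCharacter ℂ D}
    (hprim : ψ.IsPrimitive) (hquad : ψ.IsQuadratic) (hD : 4 ≤ D) {x : ℝ} (hx : ((D : ℝ) ^ 2) ≤ x) :
    ∑ n ∈ Ioc (D ^ 2) ⌊x⌋₊, RealChar.charDivisorSum ψ n / n ≤
      ‖ψ.LFunction 1‖ * (Real.log x - 2 * Real.log D) + 2 * meanValueErr D := by
  set L : ℝ := ‖ψ.LFunction 1‖ with hL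
  set L' : ℝ := (deriv ψ.LFunction 1).re with hL'
  set γ : ℝ := Real.eulerMascheroniConstant with hγ
  have hD0 : (0 : ℝ) < D := by exact_mod_cast (show 0 < D by omega)
  have hD1 : (1 : ℝ) ≤ (D : ℝ) ^ 2 := by
    have : (1 : ℝ) ≤ D := by exact_mod_cast (show 1 ≤ D by omega)
    nlinarith
  have hx0 : 0 < x := lt_of_lt_of_le (by positivity) hx
  -- `N₁ = D² ≤ N₂ = ⌊x⌋`
  have hN : D ^ 2 ≤ ⌊x⌋₊ := Nat.le_floor (by exact_mod_cast hx)
  have h2 := meanValue_sub_le hprim hquad hD hN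
  have h1 := meanValue_sub_le hprim hquad hD (le_refl (D ^ 2))
  rw [sum_Icc_one_eq_add hN] at h2
  have hlogN2 : Real.log (⌊x⌋₊ : ℕ) ≤ Real.log x := by
    apply Real.log_le_log
    · exact_mod_cast (lt_of_lt_of_le (by positivity) hN : 0 < ⌊x⌋₊)
    · exact Nat.floor_le hx0.le
  have hlogN1 : Real.log ((D ^ 2 : ℕ) : ℝ) = 2 * Real.log D := by
    rw [Nat.cast_pow, Real.log_pow]; norm_num
  have hL0 : 0 ≤ L := norm_nonneg _
  rw [hlogN1] at h1
  have hA := (abs_le.mp h2).2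
  have hB := (abs_le.mp h1).1
  have hmono : (Real.log (⌊x⌋₊ : ℕ) + γ) * L ≤ (Real.log x + γ) * L := by gcongr
  nlinarith

/-- **The largeness condition on `D`** under which the error `2ε(D)` is absorbed by `2L(1,ψ) log D`
via the class-number floor `L(1,ψ) ≥ 0.69/√D`:
`6(1 + log D)(1 + 2 log D)/√D + 8 ≤ 1.38 log D` (a numeric condition on `D` alone; it holds for all
large `D`, `eventually_lacunarityThreshold`) — this file's rendering of the standing hypothesis
"Throughout we let `D` be large" under which Lemma 3.5 is printed.
[cite: BuiPrattZaharescu2023, §2 p. 3 ("Throughout we let D be large") and §3 Lemma 3.5] -/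
def LacunarityThreshold (D : ℕ) : Prop :=
  6 * (1 + Real.log D) * (1 + 2 * Real.log D) / Real.sqrt D + 8 ≤ 1.38 * Real.log D

/-- The threshold implies `D ≥ 4` (indeed `log D ≥ 8/1.38 > 5`).
[cite: BuiPrattZaharescu2023, §2 p. 3 ("Throughout we let D be large")] -/
theorem four_le_of_lacunarityThreshold {D : ℕ} (h : LacunarityThreshold D) : 4 ≤ D := by
  unfold LacunarityThreshold at h
  have hlogD : 0 ≤ Real.log D := Real.log_natCast_nonneg D
  have h1 : 0 ≤ 6 * (1 + Real.log D) * (1 + 2 * Real.log D) / Real.sqrt D := by positivity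
  have h2 : 5 < Real.log D := by nlinarith
  by_contra hlt
  have hle : D ≤ 3 := by omega
  have h3 : Real.log D ≤ Real.log 4 := by
    rcases Nat.eq_zero_or_pos D with h0 | hpos
    · subst h0; simp; exact Real.log_nonneg (by norm_num)
    · exact Real.log_le_log (by exact_mod_cast hpos) (by exact_mod_cast (by omega : D ≤ 4))
  have h4 : Real.log 4 < 5 := by
    have : Real.log 4 < 4 - 1 := Real.log_lt_sub_one_of_pos (by norm_num) (by norm_num)
    linarith
  linarith

/-- Under the threshold, `2ε(D) ≤ 2 L(1,ψ) log D` — the printed step "`− L(1,ψ)(log D²) + O(D^{−3/4}(log D))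
≤ 0` since `L(1,ψ) ≫ D^{−1/2}`". [cite: BuiPrattZaharescu2023, §3 proof of Lemma 3.5] -/
theorem two_mul_meanValueErr_le [NeZero D] {ψ : DirichletCharacter ℂ D} (hprim : ψ.IsPrimitive)
    (hquad : ψ.IsQuadratic) (hT : LacunarityThreshold D) :
    2 * meanValueErr D ≤ 2 * (‖ψ.LFunction 1‖ * Real.log D) := by
  have hD := four_le_of_lacunarityThreshold hT
  have hD0 : (0 : ℝ) < D := by exact_mod_cast (show 0 < D by omega)
  have hsq : 0 < Real.sqrt D := Real.sqrt_pos.mpr hD0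
  have hDsq : Real.sqrt D * Real.sqrt D = D := Real.mul_self_sqrt hD0.le
  have hfloor := norm_LFunction_one_ge hprim hquad (by omega)
  have hlogD : 0 ≤ Real.log D := Real.log_natCast_nonneg D
  unfold LacunarityThreshold at hT
  unfold meanValueErr
  -- `2ε(D) = (6(1+log D)(1+2log D)/√D + 8)/√D ≤ 1.38 log D/√D ≤ 2 L log D`
  have h1 : 2 * (3 * (1 + Real.log D) * (1 + 2 * Real.log D) / D + 4 / Real.sqrt D) =
      (6 * (1 + Real.log D) * (1 + 2 * Real.log D) / Real.sqrt D + 8) / Real.sqrt D := by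
    rw [add_div, div_div, hDsq]; ring
  rw [h1, div_le_iff₀ hsq]
  have h2 : (69 / 100) / Real.sqrt D * Real.sqrt D = 69 / 100 := by field_simp
  calc 6 * (1 + Real.log D) * (1 + 2 * Real.log D) / Real.sqrt D + 8
      ≤ 1.38 * Real.log D := hT
    _ = 2 * ((69 / 100) / Real.sqrt D * Real.sqrt D) * Real.log D := by rw [h2]; ring
    _ ≤ 2 * (‖ψ.LFunction 1‖ * Real.sqrt D) * Real.log D := by gcongr
    _ = 2 * (‖ψ.LFunction 1‖ * Real.log D) * Real.sqrt D := by ring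

end BPZ2024

open BPZ2024 in
/-- **Bui–Pratt–Zaharescu 2024, Lemma 3.5 (lacunarity of `1⋆ψ` beyond `D²`)**, as printed, for every
`D` satisfying the explicit largeness condition `BPZ2024.LacunarityThreshold D` and every primitive
quadratic `ψ` mod `D` (the source: `ψ` real, ODD, primitive, `D` large): for real `x ≥ D²`,
`∑_{D² < n ≤ x} (1⋆ψ)(n)/n ≤ L(1,ψ) log x`.
PROVED (tree mean value MV Ex. 11.2.3(g) = IK (22.109) + Pólya–Vinogradov + class-number floor).
[cite: BuiPrattZaharescu2023, §3 Lemma 3.5 p. 8]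
[cite: BuiPrattZaharescu2021, §2 (display after IK (22.109))] -/
theorem buiPrattZaharescu2024_lemma35 {D : ℕ} [NeZero D] {ψ : DirichletCharacter ℂ D}
    (hprim : ψ.IsPrimitive) (hquad : ψ.IsQuadratic) (hT : BPZ2024.LacunarityThreshold D)
    {x : ℝ} (hx : ((D : ℝ) ^ 2) ≤ x) :
    ∑ n ∈ Ioc (D ^ 2) ⌊x⌋₊, RealChar.charDivisorSum ψ n / n ≤ ‖ψ.LFunction 1‖ * Real.log x := by
  have hD := four_le_of_lacunarityThreshold hT
  have h1 := sum_Ioc_charDivisorSum_div_le_explicit hprim hquad hD hx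
  have h2 := two_mul_meanValueErr_le hprim hquad hT
  nlinarith

namespace BPZ2024

variable {D : ℕ}

/-- **The threshold holds for all large `D`** (`(1 + log D)² D^{−1/2} → 0`, `log D → ∞`): the
standing hypothesis "`D` large" of the source is met from some explicit `D₀` on.
[cite: BuiPrattZaharescu2023, §2 p. 3 ("Throughout we let D be large")] -/
theorem eventually_lacunarityThreshold : ∃ D₀ : ℕ, ∀ D : ℕ, D₀ ≤ D → LacunarityThreshold D := by
  -- real-variable statement first
  have h1 : Tendsto (fun u : ℝ => (1 + Real.log u) ^ 2 * u ^ (-(1 / 2 : ℝ))) atTop (𝓝 0) :=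
    SiegelZero.tendsto_one_add_log_sq_mul_rpow_neg (by norm_num)
  have h2 : Tendsto (fun u : ℝ => Real.log u) atTop atTop := Real.tendsto_log_atTop
  have e1 : ∀ᶠ u : ℝ in atTop, (1 + Real.log u) ^ 2 * u ^ (-(1 / 2 : ℝ)) ≤ 1 / 12 :=
    h1.eventually (eventually_le_nhds (by norm_num))
  have e2 : ∀ᶠ u : ℝ in atTop, 9 ≤ Real.log u := h2.eventually_ge_atTop 9
  have e3 : ∀ᶠ u : ℝ in atTop, 1 ≤ u := eventually_ge_atTop 1
  have e := (e1.and (e2.and e3))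
  rw [Filter.eventually_atTop] at e
  obtain ⟨u₀, hu₀⟩ := e
  refine ⟨⌈u₀⌉₊, fun D hD => ?_⟩
  have hDu : u₀ ≤ (D : ℝ) := (Nat.le_ceil u₀).trans (by exact_mod_cast hD)
  obtain ⟨hA, hB, hC⟩ := hu₀ D hDu
  unfold LacunarityThreshold
  have hD0 : (0 : ℝ) < D := by linarith
  have hsq : 0 < Real.sqrt D := Real.sqrt_pos.mpr hD0
  have hlog : 0 ≤ Real.log D := by linarith
  -- `u^{-1/2} = 1/√u`
  have hrpow : (D : ℝ) ^ (-(1 / 2 : ℝ)) = 1 / Real.sqrt D := by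
    rw [Real.rpow_neg hD0.le, Real.sqrt_eq_rpow, inv_eq_one_div]
  rw [hrpow] at hA
  -- `(1 + log D)(1 + 2 log D) ≤ 2 (1 + log D)²`
  have hprod : 6 * (1 + Real.log D) * (1 + 2 * Real.log D) / Real.sqrt D ≤
      12 * ((1 + Real.log D) ^ 2 * (1 / Real.sqrt D)) := by
    rw [div_eq_mul_one_div]
    have : (1 + Real.log D) * (1 + 2 * Real.log D) ≤ 2 * (1 + Real.log D) ^ 2 := by nlinarith
    have h' : 0 ≤ 1 / Real.sqrt D := by positivity
    nlinarith
  nlinarith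

end BPZ2024

open BPZ2024 in
/-- **Lemma 3.5 in the printed quantifier shape** ("`D` large"): there is `D₀` such that for all
`D ≥ D₀`, all primitive quadratic `ψ` mod `D` and all real `x ≥ D²`,
`∑_{D² < n ≤ x} (1⋆ψ)(n)/n ≤ L(1,ψ) log x`. PROVED. [cite: BuiPrattZaharescu2023, §3 Lemma 3.5 p. 8] -/
theorem buiPrattZaharescu2024_lemma35_eventually :
    ∃ D₀ : ℕ, ∀ (D : ℕ) [NeZero D], D₀ ≤ D → ∀ ψ : DirichletCharacter ℂ D, ψ.IsPrimitive →
      ψ.IsQuadratic → ∀ x : ℝ, ((D : ℝ) ^ 2) ≤ x →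
        ∑ n ∈ Ioc (D ^ 2) ⌊x⌋₊, RealChar.charDivisorSum ψ n / n ≤ ‖ψ.LFunction 1‖ * Real.log x := by
  obtain ⟨D₀, hD₀⟩ := eventually_lacunarityThreshold
  exact ⟨D₀, fun D _ hD ψ hprim hquad x hx => buiPrattZaharescu2024_lemma35 hprim hquad (hD₀ D hD) hx⟩

namespace BPZ2024

variable {D : ℕ}

/-! ### The split primes `ψ(p) = 1` in `(D, x]`: the tensor-power bound of the proof of Lemma 3.7 -/

open Classical in
/-- The **split primes** of `ψ` in a finite set `s`: the primes `p ∈ s` with `ψ(p) = 1` (the index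
set "`p ≤ x, ψ(p) = 1`" of Lemma 3.7; for `p > D` the same as "`ψ(p) ≠ −1`", the tree's
`SiegelZero.excPrimes`). [cite: BuiPrattZaharescu2023, §3 Lemma 3.7] -/
def splitPrimes {D : ℕ} (ψ : DirichletCharacter ℂ D) (s : Finset ℕ) : Finset ℕ :=
  s.filter fun p => p.Prime ∧ ψ (p : ZMod D) = 1

/-- Membership in `splitPrimes`: `p ∈ s`, `p` prime, `ψ(p) = 1`. [cite: BuiPrattZaharescu2023, §3 Lemma 3.7 (index set)] -/
theorem mem_splitPrimes {ψ : DirichletCharacter ℂ D} {s : Finset ℕ} {p : ℕ} :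
    p ∈ splitPrimes ψ s ↔ p ∈ s ∧ p.Prime ∧ ψ (p : ZMod D) = 1 := by
  classical
  simp [splitPrimes]

/-- `splitPrimes ψ s ⊆ s`. [cite: BuiPrattZaharescu2023, §3 Lemma 3.7 (index set)] -/
theorem splitPrimes_subset (ψ : DirichletCharacter ℂ D) (s : Finset ℕ) : splitPrimes ψ s ⊆ s := by
  classical
  exact Finset.filter_subset _ _

/-- At a split prime, `λ(p) = 1 + Re ψ(p) = 2`. [cite: BuiPrattZaharescu2023, §3 proof of Lemma 3.7] -/
theorem charDivisorSum_splitPrime {ψ : DirichletCharacter ℂ D} (hquad : ψ.IsQuadratic) {p : ℕ}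
    (hp : p.Prime) (hψ : ψ (p : ZMod D) = 1) : RealChar.charDivisorSum ψ p = 2 := by
  rw [RealChar.charDivisorSum_prime ψ hquad.sq_eq_one hp, reChar_apply ψ hp.ne_zero, hψ,
    Complex.one_re]
  norm_num

/-- For two distinct split primes, `λ(p₁p₂) = 4` (multiplicativity).
[cite: BuiPrattZaharescu2023, §3 proof of Lemma 3.7] -/
theorem charDivisorSum_mul_splitPrimes {ψ : DirichletCharacter ℂ D} (hquad : ψ.IsQuadratic)
    {p₁ p₂ : ℕ} (hp₁ : p₁.Prime) (hp₂ : p₂.Prime) (hne : p₁ ≠ p₂) (h₁ : ψ (p₁ : ZMod D) = 1)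
    (h₂ : ψ (p₂ : ZMod D) = 1) : RealChar.charDivisorSum ψ (p₁ * p₂) = 4 := by
  have hcop : Nat.Coprime p₁ p₂ := (Nat.coprime_primes hp₁ hp₂).mpr hne
  rw [(RealChar.isMultiplicative_charDivisorSum ψ hquad.sq_eq_one).map_mul_of_coprime hcop,
    charDivisorSum_splitPrime hquad hp₁ h₁, charDivisorSum_splitPrime hquad hp₂ h₂]
  norm_num

/-- Products of ordered pairs of primes `p₁ < p₂` determine the pair. [folklore] -/
private theorem injOn_mul_of_prime_lt (T : Finset (ℕ × ℕ))
    (hT : ∀ ab ∈ T, ab.1.Prime ∧ ab.2.Prime ∧ ab.1 < ab.2) :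
    Set.InjOn (fun ab : ℕ × ℕ => ab.1 * ab.2) T := by
  intro ab hab cd hcd heq
  obtain ⟨ha, hb, hab'⟩ := hT ab hab
  obtain ⟨hc, hd, hcd'⟩ := hT cd hcd
  simp only at heq
  -- `a ∣ c*d`, so `a = c` or `a = d`
  have hadvd : ab.1 ∣ cd.1 * cd.2 := ⟨ab.2, heq.symm⟩
  rcases (Nat.Prime.dvd_mul ha).mp hadvd with h | h
  · have hac : ab.1 = cd.1 := (Nat.prime_dvd_prime_iff_eq ha hc).mp h
    have hbd : ab.2 = cd.2 := by
      rw [hac] at heq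
      exact Nat.eq_of_mul_eq_mul_left hc.pos heq
    exact Prod.ext hac hbd
  · have had : ab.1 = cd.2 := (Nat.prime_dvd_prime_iff_eq ha hd).mp h
    -- then `b = c`, contradicting the orderings
    have hbc : ab.2 = cd.1 := by
      rw [had, mul_comm] at heq
      exact Nat.eq_of_mul_eq_mul_right hd.pos heq
    omega

/-- The off-diagonal, one ordering: `∑_{p₁ < p₂ split in (D, M]} λ(p₁p₂)/(p₁p₂) ≤ ∑_{D² < n ≤ M²} λ(n)/n`.
[cite: BuiPrattZaharescu2023, §3 proof of Lemma 3.7 (first display)] -/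
theorem sum_offDiag_lt_le [NeZero D] {ψ : DirichletCharacter ℂ D} (hquad : ψ.IsQuadratic) (M : ℕ) :
    ∑ ab ∈ ((splitPrimes ψ (Ioc D M)) ×ˢ (splitPrimes ψ (Ioc D M))).filter (fun ab => ab.1 < ab.2),
        RealChar.charDivisorSum ψ (ab.1 * ab.2) / ((ab.1 : ℝ) * ab.2) ≤
      ∑ n ∈ Ioc (D ^ 2) (M ^ 2), RealChar.charDivisorSum ψ n / n := by
  classical
  set P := splitPrimes ψ (Ioc D M) with hP
  set T := (P ×ˢ P).filter (fun ab : ℕ × ℕ => ab.1 < ab.2) with hTdef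
  have hT : ∀ ab ∈ T, ab.1.Prime ∧ ab.2.Prime ∧ ab.1 < ab.2 := by
    intro ab hab
    rw [hTdef, Finset.mem_filter, Finset.mem_product] at hab
    exact ⟨(mem_splitPrimes.mp hab.1.1).2.1, (mem_splitPrimes.mp hab.1.2).2.1, hab.2⟩
  have hinj := injOn_mul_of_prime_lt T hT
  -- rewrite as a sum over the image
  have heq : ∑ ab ∈ T, RealChar.charDivisorSum ψ (ab.1 * ab.2) / ((ab.1 : ℝ) * ab.2) =
      ∑ n ∈ T.image (fun ab : ℕ × ℕ => ab.1 * ab.2), RealChar.charDivisorSum ψ n / n := by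
    rw [Finset.sum_image hinj]
    refine Finset.sum_congr rfl fun ab _ => ?_
    rw [Nat.cast_mul]
  rw [heq]
  apply Finset.sum_le_sum_of_subset_of_nonneg
  · intro n hn
    rw [Finset.mem_image] at hn
    obtain ⟨ab, hab, rfl⟩ := hn
    rw [hTdef, Finset.mem_filter, Finset.mem_product] at hab
    have ha := (mem_splitPrimes.mp hab.1.1).1
    have hb := (mem_splitPrimes.mp hab.1.2).1
    rw [Finset.mem_Ioc] at ha hb ⊢
    constructor <;> nlinarith [ha.1, ha.2, hb.1, hb.2]
  · intro n _ _
    exact div_nonneg (RealChar.charDivisorSum_nonneg ψ hquad.sq_eq_one n) (Nat.cast_nonneg n)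

/-- **The tensor-power bound of the proof of Lemma 3.7 (first display), explicit**: for `ψ` primitive
quadratic mod `D` with `BPZ2024.LacunarityThreshold D` and real `x ≥ D`,
`(∑_{D < p ≤ x, ψ(p)=1} 1/p)² ≤ L(1,ψ) log x + 1/D`
(diagonal `≤ ∑_{p > D} 1/p² ≤ 1/D`; each off-diagonal ordering `≤ ¼ ∑_{D² < n ≤ x²} λ(n)/n ≤ ½ L(1,ψ) log x`
by Lemma 3.5 at `x²`). PROVED. [cite: BuiPrattZaharescu2023, §3 proof of Lemma 3.7, p. 10 l. 12–24] -/
theorem sq_sum_inv_splitPrimes_le [NeZero D] {ψ : DirichletCharacter ℂ D} (hprim : ψ.IsPrimitive)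
    (hquad : ψ.IsQuadratic) (hT : LacunarityThreshold D) {x : ℝ} (hx : (D : ℝ) ≤ x) :
    (∑ p ∈ splitPrimes ψ (Ioc D ⌊x⌋₊), (1 : ℝ) / p) ^ 2 ≤ ‖ψ.LFunction 1‖ * Real.log x + 1 / D := by
  classical
  have hD := four_le_of_lacunarityThreshold hT
  have hD0 : (0 : ℝ) < D := by exact_mod_cast (show 0 < D by omega)
  have hx0 : 0 < x := lt_of_lt_of_le hD0 hx
  have hx1 : 1 ≤ x := le_trans (by exact_mod_cast (show 1 ≤ D by omega)) hx
  set M : ℕ := ⌊x⌋₊ with hM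
  have hDM : D ≤ M := Nat.le_floor hx
  set P := splitPrimes ψ (Ioc D M) with hP
  set L : ℝ := ‖ψ.LFunction 1‖ with hL
  have hL0 : 0 ≤ L := norm_nonneg _
  set g : ℕ → ℝ := fun n => RealChar.charDivisorSum ψ n / n with hg
  -- Lemma 3.5 at `x' = M²` (a natural number `≥ D²`): `∑_{D² < n ≤ M²} g(n) ≤ L log(M²) ≤ 2 L log x`
  have h35 : ∑ n ∈ Ioc (D ^ 2) (M ^ 2), g n ≤ 2 * (L * Real.log x) := by
    have hx' : ((D : ℝ) ^ 2) ≤ ((M ^ 2 : ℕ) : ℝ) := by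
      rw [Nat.cast_pow]; exact pow_le_pow_left₀ hD0.le (by exact_mod_cast hDM) 2
    have h := buiPrattZaharescu2024_lemma35 hprim hquad hT hx'
    rw [Nat.floor_natCast, Nat.cast_pow, Real.log_pow, Nat.cast_ofNat] at h
    have hlogM : Real.log (M : ℝ) ≤ Real.log x :=
      Real.log_le_log (by exact_mod_cast (show 0 < M by omega)) (Nat.floor_le hx0.le)
    have hlogM0 : 0 ≤ Real.log (M : ℝ) := Real.log_natCast_nonneg M
    nlinarith
  -- expand the square as a double sum over `P ×ˢ P`
  have hsq : (∑ p ∈ P, (1 : ℝ) / p) ^ 2 = ∑ ab ∈ P ×ˢ P, (1 : ℝ) / ((ab.1 : ℝ) * ab.2) := by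
    rw [sq, Finset.sum_mul_sum, Finset.sum_product]
    refine Finset.sum_congr rfl fun a _ => Finset.sum_congr rfl fun b _ => ?_
    rw [one_div_mul_one_div]
  rw [hsq]
  -- split `P ×ˢ P` into the diagonal, `a < b` and `b < a`
  have hsplit : ∑ ab ∈ P ×ˢ P, (1 : ℝ) / ((ab.1 : ℝ) * ab.2) =
      ∑ ab ∈ (P ×ˢ P).filter (fun ab => ab.1 = ab.2), (1 : ℝ) / ((ab.1 : ℝ) * ab.2) +
      (∑ ab ∈ (P ×ˢ P).filter (fun ab => ab.1 < ab.2), (1 : ℝ) / ((ab.1 : ℝ) * ab.2) +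
       ∑ ab ∈ (P ×ˢ P).filter (fun ab => ab.2 < ab.1), (1 : ℝ) / ((ab.1 : ℝ) * ab.2)) := by
    rw [← Finset.sum_filter_add_sum_filter_not (P ×ˢ P) (fun ab => ab.1 = ab.2)]
    congr 1
    rw [← Finset.sum_filter_add_sum_filter_not ((P ×ˢ P).filter (fun ab => ¬ab.1 = ab.2))
      (fun ab => ab.1 < ab.2), Finset.filter_filter, Finset.filter_filter]
    congr 1
    · refine Finset.sum_congr (Finset.filter_congr fun ab _ => ?_) fun _ _ => rfl
      constructor
      · rintro ⟨_, h⟩; exact h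
      · intro h; exact ⟨h.ne, h⟩
    · refine Finset.sum_congr (Finset.filter_congr fun ab _ => ?_) fun _ _ => rfl
      omega
  rw [hsplit]
  -- (a) the diagonal: `∑_{p ∈ P} 1/p² ≤ ∑_{D < a ≤ M} 1/a² ≤ 1/D`
  have hdiag : ∑ ab ∈ (P ×ˢ P).filter (fun ab => ab.1 = ab.2), (1 : ℝ) / ((ab.1 : ℝ) * ab.2) ≤
      1 / D := by
    -- the diagonal is the image of `P` under `p ↦ (p, p)`
    have himg : (P ×ˢ P).filter (fun ab : ℕ × ℕ => ab.1 = ab.2) = P.image (fun p => (p, p)) := by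
      ext ⟨a, b⟩
      simp only [Finset.mem_filter, Finset.mem_product, Finset.mem_image, Prod.mk.injEq]
      constructor
      · rintro ⟨⟨ha, _⟩, rfl⟩; exact ⟨a, ha, rfl, rfl⟩
      · rintro ⟨p, hp, rfl, rfl⟩; exact ⟨⟨hp, hp⟩, rfl⟩
    rw [himg, Finset.sum_image (fun p _ q _ h => (Prod.mk.injEq _ _ _ _).mp h |>.1)]
    simp only
    calc ∑ p ∈ P, (1 : ℝ) / ((p : ℝ) * p) ≤ ∑ a ∈ Ioc D M, (1 : ℝ) / ((a : ℝ) * a) := by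
          apply Finset.sum_le_sum_of_subset_of_nonneg (splitPrimes_subset ψ _)
          intro a _ _; positivity
      _ = ∑ a ∈ Ioc D M, (1 : ℝ) / ((a : ℝ) ^ 2) := Finset.sum_congr rfl fun a _ => by rw [sq]
      _ ≤ 1 / D - 1 / M := sum_Ioc_inv_sq_le (by omega) hDM
      _ ≤ 1 / D := by
          have : (0 : ℝ) ≤ 1 / M := by positivity
          linarith
  -- (b) the two off-diagonal orderings
  have hoff : ∀ ab ∈ P ×ˢ P, ab.1 ≠ ab.2 →
      (1 : ℝ) / ((ab.1 : ℝ) * ab.2) = (1 / 4) * (RealChar.charDivisorSum ψ (ab.1 * ab.2) / ((ab.1 : ℝ) * ab.2)) := by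
    intro ab hab hne
    rw [Finset.mem_product] at hab
    obtain ⟨_, ha, hψa⟩ := mem_splitPrimes.mp hab.1
    obtain ⟨_, hb, hψb⟩ := mem_splitPrimes.mp hab.2
    rw [charDivisorSum_mul_splitPrimes hquad ha hb hne hψa hψb]
    ring
  have hlt : ∑ ab ∈ (P ×ˢ P).filter (fun ab => ab.1 < ab.2), (1 : ℝ) / ((ab.1 : ℝ) * ab.2) ≤
      (1 / 4) * (2 * (L * Real.log x)) := by
    rw [Finset.sum_congr rfl fun ab hab => hoff ab (Finset.mem_filter.mp hab).1
      (ne_of_lt (Finset.mem_filter.mp hab).2), ← Finset.mul_sum]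
    gcongr
    exact (sum_offDiag_lt_le hquad M).trans h35
  have hgt : ∑ ab ∈ (P ×ˢ P).filter (fun ab => ab.2 < ab.1), (1 : ℝ) / ((ab.1 : ℝ) * ab.2) ≤
      (1 / 4) * (2 * (L * Real.log x)) := by
    -- swap the two coordinates and reduce to `hlt`'s bound
    have hswap : ∑ ab ∈ (P ×ˢ P).filter (fun ab => ab.2 < ab.1), (1 : ℝ) / ((ab.1 : ℝ) * ab.2) =
        ∑ ab ∈ (P ×ˢ P).filter (fun ab => ab.1 < ab.2),
          RealChar.charDivisorSum ψ (ab.1 * ab.2) / ((ab.1 : ℝ) * ab.2) * (1 / 4) := by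
      rw [Finset.sum_congr rfl fun ab hab => hoff ab (Finset.mem_filter.mp hab).1
        (ne_of_gt (Finset.mem_filter.mp hab).2)]
      refine Finset.sum_nbij' (fun ab => ab.swap) (fun ab => ab.swap) ?_ ?_ ?_ ?_ ?_
      · intro ab hab
        rw [Finset.mem_filter, Finset.mem_product] at hab ⊢
        exact ⟨⟨hab.1.2, hab.1.1⟩, hab.2⟩
      · intro ab hab
        rw [Finset.mem_filter, Finset.mem_product] at hab ⊢
        exact ⟨⟨hab.1.2, hab.1.1⟩, hab.2⟩
      · intro ab _; rfl
      · intro ab _; rfl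
      · intro ab _
        simp only [Prod.fst_swap, Prod.snd_swap]
        rw [mul_comm ab.2 ab.1, mul_comm (ab.2 : ℝ) (ab.1 : ℝ)]
        ring
    rw [hswap, ← Finset.sum_mul]
    have := (sum_offDiag_lt_le hquad M).trans h35
    nlinarith
  nlinarith

/-- **The printed shape**: `(∑_{D < p ≤ x, ψ(p)=1} 1/p)² ≤ 2 L(1,ψ) log x` ("`≪ L(1,ψ)(log x)`, where in
the last inequality we have used the lower bound `L(1,ψ) ≫ D^{−1/2}`"; here `1/D ≤ L(1,ψ) log x`
since `L(1,ψ) ≥ 0.69/√D` and `log x ≥ log D > 5`). PROVED.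
[cite: BuiPrattZaharescu2023, §3 proof of Lemma 3.7, p. 10 l. 14–21] -/
theorem sq_sum_inv_splitPrimes_le' [NeZero D] {ψ : DirichletCharacter ℂ D} (hprim : ψ.IsPrimitive)
    (hquad : ψ.IsQuadratic) (hT : LacunarityThreshold D) {x : ℝ} (hx : (D : ℝ) ≤ x) :
    (∑ p ∈ splitPrimes ψ (Ioc D ⌊x⌋₊), (1 : ℝ) / p) ^ 2 ≤ 2 * (‖ψ.LFunction 1‖ * Real.log x) := by
  have h := sq_sum_inv_splitPrimes_le hprim hquad hT hx
  have hD := four_le_of_lacunarityThreshold hT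
  have hD0 : (0 : ℝ) < D := by exact_mod_cast (show 0 < D by omega)
  have hsq : 0 < Real.sqrt D := Real.sqrt_pos.mpr hD0
  have hDsq : Real.sqrt D * Real.sqrt D = D := Real.mul_self_sqrt hD0.le
  have hfloor := norm_LFunction_one_ge hprim hquad (by omega)
  -- `log x ≥ log D > 5`
  have hlogD : 5 < Real.log D := by
    have hT' := hT
    unfold LacunarityThreshold at hT'
    have hlog0 : 0 ≤ Real.log D := Real.log_natCast_nonneg D
    have : 0 ≤ 6 * (1 + Real.log D) * (1 + 2 * Real.log D) / Real.sqrt D := by positivity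
    nlinarith
  have hlogx : Real.log D ≤ Real.log x := Real.log_le_log hD0 hx
  -- `1/D ≤ (0.69/√D)·(1/√D)·(1/0.69) ≤ L · 5 · (...)`: concretely `1/D ≤ L log x`
  have h1 : 1 / (D : ℝ) ≤ ‖ψ.LFunction 1‖ * Real.log x := by
    have hsqD : 1 ≤ Real.sqrt D := by
      rw [show (1 : ℝ) = Real.sqrt 1 by simp]
      exact Real.sqrt_le_sqrt (by exact_mod_cast (show 1 ≤ D by omega))
    have this : 1 / Real.sqrt D ≤ 1 := by rw [div_le_one hsq]; exact hsqD
    have h' : 0 ≤ 1 / Real.sqrt D := by positivity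
    calc 1 / (D : ℝ) = (1 / Real.sqrt D) * (1 / Real.sqrt D) := by
          rw [one_div_mul_one_div, hDsq]
      _ ≤ (1 / Real.sqrt D) * 1 := by gcongr
      _ ≤ ((69 / 100) * 5) / Real.sqrt D := by
          rw [mul_one, div_le_div_iff_of_pos_right hsq]; norm_num
      _ = ((69 / 100) / Real.sqrt D) * 5 := by ring
      _ ≤ ‖ψ.LFunction 1‖ * Real.log x :=
          mul_le_mul hfloor (le_of_lt (lt_of_lt_of_le hlogD hlogx)) (by norm_num) (norm_nonneg _)
  linarith

/-! ### Lemma 3.8 (i): `L'(1, ψ)` is the head `∑_{n ≤ D²} λ(n)/n` up to `O(L(1,ψ) log D)` -/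

end BPZ2024

open BPZ2024 in
/-- **Bui–Pratt–Zaharescu 2024, Lemma 3.8, first half**, with an explicit constant: for `ψ` primitive
quadratic mod `D` with `BPZ2024.LacunarityThreshold D`,
`|L'(1,ψ) − ∑_{n ≤ D²} (1⋆ψ)(n)/n| ≤ 4 L(1,ψ) log D`
(printed: `L'(1,ψ) = ∑_{n ≤ D²}(1⋆ψ)(n)/n + O(L(1,ψ)(log D))`; `L'(1,ψ)` real for real `ψ`, stated for
`Re L'(1,ψ)`). PROVED (mean value at `N = D²`: `|S(D²) − L' − (2 log D + γ)L| ≤ ε(D) ≤ L log D`, `γ < 2/3`).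
[cite: BuiPrattZaharescu2023, §3 Lemma 3.8 p. 11 l. 2–8] -/
theorem buiPrattZaharescu2024_lemma38_deriv {D : ℕ} [NeZero D] {ψ : DirichletCharacter ℂ D}
    (hprim : ψ.IsPrimitive) (hquad : ψ.IsQuadratic) (hT : BPZ2024.LacunarityThreshold D) :
    |(deriv ψ.LFunction 1).re - ∑ n ∈ Icc 1 (D ^ 2), RealChar.charDivisorSum ψ n / n| ≤
      4 * (‖ψ.LFunction 1‖ * Real.log D) := by
  have hD := four_le_of_lacunarityThreshold hT
  have h := meanValue_sub_le hprim hquad hD (le_refl (D ^ 2))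
  have hE := two_mul_meanValueErr_le hprim hquad hT
  have hlogN1 : Real.log ((D ^ 2 : ℕ) : ℝ) = 2 * Real.log D := by
    rw [Nat.cast_pow, Real.log_pow]; norm_num
  rw [hlogN1] at h
  have hL0 : 0 ≤ ‖ψ.LFunction 1‖ := norm_nonneg _
  have hγ1 : Real.eulerMascheroniConstant < 2 / 3 := Real.eulerMascheroniConstant_lt_two_thirds
  have hγ0 : 0 < Real.eulerMascheroniConstant :=
    lt_trans (by norm_num) Real.one_half_lt_eulerMascheroniConstant
  -- `2/3 ≤ log D` (`log D > 5` under the threshold)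
  have hlogD : 2 / 3 ≤ Real.log D := by
    have hT' := hT
    unfold LacunarityThreshold at hT'
    have hlog0 : 0 ≤ Real.log D := Real.log_natCast_nonneg D
    have : 0 ≤ 6 * (1 + Real.log D) * (1 + 2 * Real.log D) / Real.sqrt D := by positivity
    nlinarith
  rw [abs_le] at h ⊢
  obtain ⟨h1, h2⟩ := h
  have hγL : Real.eulerMascheroniConstant * ‖ψ.LFunction 1‖ ≤ Real.log D * ‖ψ.LFunction 1‖ := by
    gcongr; linarith
  constructor <;> nlinarith

/-! ### Lemma 3.7 (named fact) -/

/-- **Bui–Pratt–Zaharescu 2024, Lemma 3.7** (sparsity of the split primes, all `p ≤ x`, weights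
`(log p)/p`), with the standing assumptions of §2 explicit ("`D` large; `ψ` real, odd, primitive mod `D`;
`L(1,ψ)(log D) = o(1)`" — here: `D ≥ D₀` and `L(1,ψ) log D ≤ c₀` for absolute `D₀`, `c₀ > 0`, and an
absolute implied constant `C`): for every real `x ≥ D`,
`∑_{p ≤ x, ψ(p)=1} (log p)/p ≤ C·( (log log(1/t)/log(1/t))·log D + L(1,ψ)^{1/2}(log x)^{3/2} )`,
`t = L(1,ψ) log D`. NAMED FACT (D-0014; not proved here: the range `D^κ < p ≤ D` rests on
Friedlander–Iwaniec 2013, Proposition 3.1, not in the tree). Status: theorem-in-print.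
[cite: BuiPrattZaharescu2023, §3 Lemma 3.7 p. 10 l. 5–11] -/
def buiPrattZaharescu2024_lemma37 : Prop :=
  ∃ C : ℝ, 0 < C ∧ ∃ c₀ : ℝ, 0 < c₀ ∧ ∃ D₀ : ℕ, ∀ (D : ℕ) [NeZero D], D₀ ≤ D →
    ∀ ψ : DirichletCharacter ℂ D, ψ.IsPrimitive → ψ.IsQuadratic → ψ.Odd →
      ‖ψ.LFunction 1‖ * Real.log D ≤ c₀ →
      ∀ x : ℝ, (D : ℝ) ≤ x →
        ∑ p ∈ BPZ2024.splitPrimes ψ (Finset.Iic ⌊x⌋₊), Real.log p / p ≤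
          C * (Real.log (Real.log (1 / (‖ψ.LFunction 1‖ * Real.log D))) /
                Real.log (1 / (‖ψ.LFunction 1‖ * Real.log D)) * Real.log D +
              ‖ψ.LFunction 1‖ ^ (1 / 2 : ℝ) * (Real.log x) ^ (3 / 2 : ℝ))



/-! ## Discharge of Lemma 3.7 (appended 2026-08-26): the `k`-fold tensor-power bound

We PROVE `buiPrattZaharescu2024_lemma37` following the printed proof (p. 10): the range `D < p ≤ x` by
the square bound `BPZ2024.sq_sum_inv_splitPrimes_le'` above; the range `p ≤ D^κ` trivially (Mertens,
tree `MertensBound.sum_log_div_prime_le`); and the range `D^κ < p ≤ D` — where the source invokes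
"Proposition 3.1 of [10]" (Friedlander–Iwaniec 2013, "a more sophisticated version of the tensor power
trick", not in the tree) — by an in-file `k`-FOLD tensor-power bound over SQUAREFREE products
(elementary symmetric functions `e_j` of the weights `1/p`): `S·e_j ≤ (j+1)e_{j+1} + j·a_max·e_j`,
hence `(S − k·a_max)^k ≤ k!·e_k`, while `e_k ≤ 2^{−k} ∑_{D² < n ≤ D^k} λ(n)/n ≤ 2^{−k}·k·L(1,ψ) log D`
by Lemma 3.5 (split `p₁ < ⋯ < p_k` give `λ(p₁⋯p_k) = 2^k`). Parameters (ours): `κ = 2/k`,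
`k = ⌈ℓ/(2 log ℓ)⌉`, `ℓ = log(1/(L(1,ψ) log D))`; constants `C = 115`, `c₀ = e^{−e}` (so that
`log ℓ ≥ 1`), `D₀ = max(D₀(threshold), 5)`. A genuinely shorter road than vendoring [10, Prop. 3.1]:
the exponent obtained is `t^{1/k} ≍ (log(1/t))^{−2}` exactly as in the printed use of [10].
-/

namespace BPZ2024

variable {D : ℕ}

section TensorPower

variable {α : Type*} [DecidableEq α]

/-- **Double counting** for the elementary symmetric sums: choosing a `j`-set `Q ⊆ P` and then a point
`p ∈ P \ Q` is choosing a `(j+1)`-set `R ⊆ P` and a point of `R`: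
`∑_{|Q| = j} ∑_{p ∈ P \ Q} F(Q ∪ {p}) = (j+1) ∑_{|R| = j+1} F(R)`.
[cite: BuiPrattZaharescu2023, §3 proof of Lemma 3.7 ("tensor power trick")] -/
theorem sum_powersetCard_sum_sdiff_insert (P : Finset α) (j : ℕ) (F : Finset α → ℝ) :
    ∑ Q ∈ P.powersetCard j, ∑ p ∈ P \ Q, F (insert p Q) =
      ((j : ℝ) + 1) * ∑ R ∈ P.powersetCard (j + 1), F R := by
  -- RHS as a double sum `Σ_R Σ_{p ∈ R} F R`
  have hR : ∀ R ∈ P.powersetCard (j + 1), ((j : ℝ) + 1) * F R = ∑ _p ∈ R, F R := by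
    intro R hR
    rw [Finset.sum_const, (Finset.mem_powersetCard.mp hR).2, nsmul_eq_mul]
    push_cast; ring
  rw [Finset.mul_sum, Finset.sum_congr rfl hR]
  -- both sides as sums over pairs
  have hL : ∑ Q ∈ P.powersetCard j, ∑ p ∈ P \ Q, F (insert p Q) =
      ∑ x ∈ (P.powersetCard j ×ˢ P).filter (fun x => x.2 ∉ x.1), F (insert x.2 x.1) := by
    rw [Finset.sum_filter, Finset.sum_product]
    refine Finset.sum_congr rfl fun Q _ => ?_
    rw [Finset.sdiff_eq_filter, Finset.sum_filter]
  have hR' : ∑ R ∈ P.powersetCard (j + 1), ∑ _p ∈ R, F R =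
      ∑ y ∈ (P.powersetCard (j + 1) ×ˢ P).filter (fun y => y.2 ∈ y.1), F y.1 := by
    rw [Finset.sum_filter, Finset.sum_product]
    refine Finset.sum_congr rfl fun R hR => ?_
    have hRP : R ⊆ P := (Finset.mem_powersetCard.mp hR).1
    rw [← Finset.sum_filter, Finset.filter_mem_eq_inter, Finset.inter_eq_right.mpr hRP]
  rw [hL, hR']
  refine Finset.sum_nbij' (fun x => (insert x.2 x.1, x.2)) (fun y => (y.1.erase y.2, y.2))
    ?_ ?_ ?_ ?_ ?_
  · intro x hx
    rw [Finset.mem_filter, Finset.mem_product, Finset.mem_powersetCard] at hx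
    obtain ⟨⟨⟨hQP, hcard⟩, hp⟩, hnot⟩ := hx
    rw [Finset.mem_filter, Finset.mem_product, Finset.mem_powersetCard]
    exact ⟨⟨⟨Finset.insert_subset hp hQP, by rw [Finset.card_insert_of_notMem hnot, hcard]⟩, hp⟩,
      Finset.mem_insert_self _ _⟩
  · intro y hy
    rw [Finset.mem_filter, Finset.mem_product, Finset.mem_powersetCard] at hy
    obtain ⟨⟨⟨hRP, hcard⟩, hp⟩, hmem⟩ := hy
    rw [Finset.mem_filter, Finset.mem_product, Finset.mem_powersetCard]
    refine ⟨⟨⟨(Finset.erase_subset _ _).trans hRP, ?_⟩, hp⟩, fun h => (Finset.mem_erase.mp h).1 rfl⟩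
    rw [Finset.card_erase_of_mem hmem, hcard]
    simp
  · intro x hx
    rw [Finset.mem_filter] at hx
    exact Prod.ext (Finset.erase_insert hx.2) rfl
  · intro y hy
    rw [Finset.mem_filter] at hy
    exact Prod.ext (Finset.insert_erase hy.2) rfl
  · intro x _
    rfl

/-- **One step of the tensor-power recursion**: for weights `0 ≤ a_p ≤ a_max` on `P` and
`e_j = ∑_{|Q| = j} ∏_{p ∈ Q} a_p`, `S = ∑_{p ∈ P} a_p`:
`S·e_j ≤ (j+1)·e_{j+1} + j·a_max·e_j` (the `j+1` new points give squarefree products, the `j` old ones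
are bounded by `a_max`). [cite: BuiPrattZaharescu2023, §3 proof of Lemma 3.7 ("tensor power trick")] -/
theorem sum_mul_esymm_le (P : Finset α) (a : α → ℝ) {amax : ℝ} (ha0 : ∀ p ∈ P, 0 ≤ a p)
    (hamax : ∀ p ∈ P, a p ≤ amax) (j : ℕ) :
    (∑ p ∈ P, a p) * ∑ Q ∈ P.powersetCard j, ∏ p ∈ Q, a p ≤
      ((j : ℝ) + 1) * (∑ R ∈ P.powersetCard (j + 1), ∏ p ∈ R, a p) +
        j * amax * ∑ Q ∈ P.powersetCard j, ∏ p ∈ Q, a p := by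
  have key : ∀ Q ∈ P.powersetCard j, (∑ p ∈ P, a p) * ∏ p ∈ Q, a p =
      ∑ p ∈ P \ Q, ∏ q ∈ insert p Q, a q + (∏ p ∈ Q, a p) * ∑ p ∈ Q, a p := by
    intro Q hQ
    have hQP : Q ⊆ P := (Finset.mem_powersetCard.mp hQ).1
    rw [← Finset.sum_sdiff hQP, add_mul, Finset.sum_mul]
    congr 1
    · refine Finset.sum_congr rfl fun p hp => ?_
      rw [Finset.prod_insert (Finset.mem_sdiff.mp hp).2]
    · ring
  have hbound : ∀ Q ∈ P.powersetCard j, (∏ p ∈ Q, a p) * ∑ p ∈ Q, a p ≤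
      (∏ p ∈ Q, a p) * (j * amax) := by
    intro Q hQ
    obtain ⟨hQP, hcard⟩ := Finset.mem_powersetCard.mp hQ
    have hprod : 0 ≤ ∏ p ∈ Q, a p := Finset.prod_nonneg fun p hp => ha0 p (hQP hp)
    have hsum : ∑ p ∈ Q, a p ≤ j * amax := by
      calc ∑ p ∈ Q, a p ≤ Q.card • amax :=
            Finset.sum_le_card_nsmul _ _ _ fun p hp => hamax p (hQP hp)
        _ = j * amax := by rw [hcard, nsmul_eq_mul]
    exact mul_le_mul_of_nonneg_left hsum hprod
  calc (∑ p ∈ P, a p) * ∑ Q ∈ P.powersetCard j, ∏ p ∈ Q, a p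
      = ∑ Q ∈ P.powersetCard j, (∑ p ∈ P, a p) * ∏ p ∈ Q, a p := by rw [Finset.mul_sum]
    _ = ∑ Q ∈ P.powersetCard j, ∑ p ∈ P \ Q, ∏ q ∈ insert p Q, a q +
          ∑ Q ∈ P.powersetCard j, (∏ p ∈ Q, a p) * ∑ p ∈ Q, a p := by
        rw [← Finset.sum_add_distrib]; exact Finset.sum_congr rfl key
    _ ≤ ((j : ℝ) + 1) * (∑ R ∈ P.powersetCard (j + 1), ∏ p ∈ R, a p) +
          ∑ Q ∈ P.powersetCard j, (∏ p ∈ Q, a p) * (j * amax) := by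
        rw [sum_powersetCard_sum_sdiff_insert P j (fun R => ∏ p ∈ R, a p)]
        exact add_le_add le_rfl (Finset.sum_le_sum hbound)
    _ = _ := by rw [← Finset.sum_mul]; ring

/-- **The `k`-fold tensor-power bound**: with the notation of `sum_mul_esymm_le`, if `S ≥ k·a_max` then
`(S − k·a_max)^j ≤ j!·e_j` for every `j ≤ k` (induction on `j`).
[cite: BuiPrattZaharescu2023, §3 proof of Lemma 3.7 ("tensor power trick")] -/
theorem sub_pow_le_factorial_mul_esymm (P : Finset α) (a : α → ℝ) {amax : ℝ} (hamax0 : 0 ≤ amax)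
    (ha0 : ∀ p ∈ P, 0 ≤ a p) (hamax : ∀ p ∈ P, a p ≤ amax) {k : ℕ}
    (hS : (k : ℝ) * amax ≤ ∑ p ∈ P, a p) {j : ℕ} (hj : j ≤ k) :
    (∑ p ∈ P, a p - k * amax) ^ j ≤ (j.factorial : ℝ) * ∑ Q ∈ P.powersetCard j, ∏ p ∈ Q, a p := by
  induction j with
  | zero => simp [Finset.powersetCard_zero]
  | succ j ih =>
    have ih' := ih (by omega)
    have hej : 0 ≤ ∑ Q ∈ P.powersetCard j, ∏ p ∈ Q, a p :=
      Finset.sum_nonneg fun Q hQ => Finset.prod_nonneg fun p hp =>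
        ha0 p ((Finset.mem_powersetCard.mp hQ).1 hp)
    have hrec := sum_mul_esymm_le P a ha0 hamax j
    have hSk : 0 ≤ ∑ p ∈ P, a p - k * amax := by linarith
    have hjk : (j : ℝ) * amax ≤ k * amax :=
      mul_le_mul_of_nonneg_right (by exact_mod_cast (by omega : j ≤ k)) hamax0
    have hstep : (∑ p ∈ P, a p - k * amax) * ∑ Q ∈ P.powersetCard j, ∏ p ∈ Q, a p ≤
        ((j : ℝ) + 1) * ∑ R ∈ P.powersetCard (j + 1), ∏ p ∈ R, a p := by
      nlinarith [mul_le_mul_of_nonneg_right hjk hej]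
    calc (∑ p ∈ P, a p - k * amax) ^ (j + 1)
        = (∑ p ∈ P, a p - k * amax) * (∑ p ∈ P, a p - k * amax) ^ j := by ring
      _ ≤ (∑ p ∈ P, a p - k * amax) * ((j.factorial : ℝ) * ∑ Q ∈ P.powersetCard j, ∏ p ∈ Q, a p) :=
          mul_le_mul_of_nonneg_left ih' hSk
      _ = (j.factorial : ℝ) * ((∑ p ∈ P, a p - k * amax) * ∑ Q ∈ P.powersetCard j, ∏ p ∈ Q, a p) := by
          ring
      _ ≤ (j.factorial : ℝ) * (((j : ℝ) + 1) * ∑ R ∈ P.powersetCard (j + 1), ∏ p ∈ R, a p) :=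
          mul_le_mul_of_nonneg_left hstep (Nat.cast_nonneg _)
      _ = ((j + 1).factorial : ℝ) * ∑ R ∈ P.powersetCard (j + 1), ∏ p ∈ R, a p := by
          rw [Nat.factorial_succ]; push_cast; ring

end TensorPower

/-- **The top elementary symmetric sum against Lemma 3.5's range**: for the split primes `P` of
`(m, D]` and `k` with `(m+1)^k > D²`, `e_k(1/p : p ∈ P) ≤ 2^{−k} ∑_{D² < n ≤ D^k} λ(n)/n`
(a `k`-set of split primes `Q` has squarefree product `n_Q ∈ (D², D^k]` with `λ(n_Q) = 2^k`, and
`Q ↦ n_Q` is injective). [cite: BuiPrattZaharescu2023, §3 proof of Lemma 3.7 ("tensor power trick")] -/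
theorem esymm_inv_splitPrimes_le {ψ : DirichletCharacter ℂ D} (hquad : ψ.IsQuadratic)
    {m k : ℕ} (hlow : D ^ 2 < (m + 1) ^ k) :
    ∑ Q ∈ (splitPrimes ψ (Ioc m D)).powersetCard k, ∏ p ∈ Q, (1 : ℝ) / p ≤
      (1 / 2) ^ k * ∑ n ∈ Ioc (D ^ 2) (D ^ k), RealChar.charDivisorSum ψ n / n := by
  classical
  set P := splitPrimes ψ (Ioc m D) with hP
  have hPprime : ∀ p ∈ P, p.Prime := fun p hp => (mem_splitPrimes.mp hp).2.1
  set g : ℕ → ℝ := fun n => RealChar.charDivisorSum ψ n / n with hg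
  -- each summand is `2^{-k} g(n_Q)`
  have hterm : ∀ Q ∈ P.powersetCard k, ∏ p ∈ Q, (1 : ℝ) / p =
      (1 / 2) ^ k * g (∏ p ∈ Q, p) := by
    intro Q hQ
    obtain ⟨hQP, hcard⟩ := Finset.mem_powersetCard.mp hQ
    have hQprime : ∀ p ∈ Q, p.Prime := fun p hp => hPprime p (hQP hp)
    have hlam : RealChar.charDivisorSum ψ (∏ p ∈ Q, p) = 2 ^ k := by
      rw [(RealChar.isMultiplicative_charDivisorSum ψ hquad.sq_eq_one).map_prod_of_prime Q hQprime,
        Finset.prod_congr rfl fun p hp => charDivisorSum_splitPrime hquad (hQprime p hp)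
          (mem_splitPrimes.mp (hQP hp)).2.2, Finset.prod_const, hcard]
    rw [hg]
    simp only
    rw [hlam, Nat.cast_prod, Finset.prod_div_distrib, Finset.prod_const_one, ← mul_div_assoc,
      ← mul_pow]
    norm_num
  rw [Finset.sum_congr rfl hterm, ← Finset.mul_sum]
  refine mul_le_mul_of_nonneg_left ?_ (by positivity)
  -- `Q ↦ n_Q` is injective on sets of primes
  have hinj : Set.InjOn (fun Q : Finset ℕ => ∏ p ∈ Q, p) ↑(P.powersetCard k) := by
    intro Q hQ Q' hQ' heq
    have h1 := Nat.primeFactors_prod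
      (fun p hp => hPprime p ((Finset.mem_powersetCard.mp (Finset.mem_coe.mp hQ)).1 hp))
    have h2 := Nat.primeFactors_prod
      (fun p hp => hPprime p ((Finset.mem_powersetCard.mp (Finset.mem_coe.mp hQ')).1 hp))
    rw [← h1, ← h2]
    exact congrArg Nat.primeFactors heq
  rw [← Finset.sum_image hinj]
  apply Finset.sum_le_sum_of_subset_of_nonneg
  · intro n hn
    rw [Finset.mem_image] at hn
    obtain ⟨Q, hQ, rfl⟩ := hn
    obtain ⟨hQP, hcard⟩ := Finset.mem_powersetCard.mp hQ
    rw [Finset.mem_Ioc]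
    constructor
    · have h := Finset.pow_card_le_prod Q (fun p => p) (m + 1) fun p hp =>
        (Finset.mem_Ioc.mp (mem_splitPrimes.mp (hQP hp)).1).1
      rw [hcard] at h
      exact lt_of_lt_of_le hlow h
    · have h := Finset.prod_le_pow_card Q (fun p => p) D fun p hp =>
        (Finset.mem_Ioc.mp (mem_splitPrimes.mp (hQP hp)).1).2
      rw [hcard] at h
      exact h
  · intro n _ _
    exact div_nonneg (RealChar.charDivisorSum_nonneg ψ hquad.sq_eq_one n) (Nat.cast_nonneg n)

/-- **The middle range `D^κ < p ≤ D`** ("Proposition 3.1 of [10]", here by the `k`-fold tensor power):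
for `ψ` primitive quadratic mod `D` (threshold `D`), `k ≥ 2` and `m` with `(m+1)^k > D²`,
`∑_{m < p ≤ D, ψ(p)=1} 1/p ≤ k·(1/(m+1) + (L(1,ψ) log D)^{1/k})`
(either the sum is `< k/(m+1)`, or `(S − k/(m+1))^k ≤ k!·e_k ≤ k!·2^{−k}·k·L(1,ψ) log D ≤ k^k·L(1,ψ) log D`).
[cite: BuiPrattZaharescu2023, §3 proof of Lemma 3.7 (range `D^κ < p ≤ D`)] -/
theorem sum_inv_splitPrimes_mid_le [NeZero D] {ψ : DirichletCharacter ℂ D} (hprim : ψ.IsPrimitive)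
    (hquad : ψ.IsQuadratic) (hT : LacunarityThreshold D) {m k : ℕ} (hk : 2 ≤ k)
    (hlow : D ^ 2 < (m + 1) ^ k) :
    ∑ p ∈ splitPrimes ψ (Ioc m D), (1 : ℝ) / p ≤
      k * (1 / ((m : ℝ) + 1) + (‖ψ.LFunction 1‖ * Real.log D) ^ (1 / (k : ℝ))) := by
  classical
  set P := splitPrimes ψ (Ioc m D) with hP
  set S := ∑ p ∈ P, (1 : ℝ) / p with hSdef
  set t := ‖ψ.LFunction 1‖ * Real.log D with htdef
  set amax : ℝ := 1 / ((m : ℝ) + 1) with hamaxdef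
  have hD := four_le_of_lacunarityThreshold hT
  have hk0 : (0 : ℝ) < k := by exact_mod_cast (show 0 < k by omega)
  have hkne : k ≠ 0 := by omega
  have hamax0 : 0 ≤ amax := by positivity
  have ha0 : ∀ p ∈ P, 0 ≤ (1 : ℝ) / p := fun p _ => by positivity
  have hamax : ∀ p ∈ P, (1 : ℝ) / p ≤ amax := by
    intro p hp
    have hp1 : m + 1 ≤ p := (Finset.mem_Ioc.mp (mem_splitPrimes.mp hp).1).1
    have : (m : ℝ) + 1 ≤ p := by exact_mod_cast hp1
    exact one_div_le_one_div_of_le (by positivity) this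
  have hlogD : 0 ≤ Real.log D := Real.log_natCast_nonneg D
  have ht0 : 0 ≤ t := by positivity
  have htk0 : 0 ≤ t ^ (1 / (k : ℝ)) := Real.rpow_nonneg ht0 _
  by_cases hS : S < k * amax
  · nlinarith
  rw [not_lt] at hS
  -- the tensor power
  have h1 := sub_pow_le_factorial_mul_esymm P (fun p => (1 : ℝ) / p) hamax0 ha0 hamax hS le_rfl
  have h2 := esymm_inv_splitPrimes_le (ψ := ψ) hquad hlow
  -- Lemma 3.5 at `x = D^k`
  have hD1 : (1 : ℝ) ≤ D := by exact_mod_cast (show 1 ≤ D by omega)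
  have hx : ((D : ℝ) ^ 2) ≤ (D : ℝ) ^ k := pow_le_pow_right₀ hD1 hk
  have h35 := buiPrattZaharescu2024_lemma35 hprim hquad hT hx
  have hfloor : ⌊(D : ℝ) ^ k⌋₊ = D ^ k := by
    rw [← Nat.cast_pow, Nat.floor_natCast]
  rw [hfloor, Real.log_pow] at h35
  have h3 : (S - k * amax) ^ k ≤ (k.factorial : ℝ) * ((1 / 2) ^ k * ((k : ℝ) * t)) := by
    calc (S - k * amax) ^ k ≤ (k.factorial : ℝ) * ∑ Q ∈ P.powersetCard k, ∏ p ∈ Q, (1 : ℝ) / p := h1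
      _ ≤ (k.factorial : ℝ) *
            ((1 / 2) ^ k * ∑ n ∈ Ioc (D ^ 2) (D ^ k), RealChar.charDivisorSum ψ n / n) :=
          mul_le_mul_of_nonneg_left h2 (Nat.cast_nonneg _)
      _ ≤ (k.factorial : ℝ) * ((1 / 2) ^ k * ((k : ℝ) * t)) := by
          rw [htdef]
          gcongr
          linarith
  -- `k!·2^{-k}·k ≤ k^k`
  have hA : (k.factorial : ℝ) * ((1 / 2) ^ k * (k : ℝ)) ≤ (k : ℝ) ^ k := by
    have hf : (k.factorial : ℝ) ≤ (k : ℝ) ^ k := by exact_mod_cast Nat.factorial_le_pow k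
    have h2k : (k : ℝ) ≤ (2 : ℝ) ^ k := by exact_mod_cast Nat.lt_two_pow_self.le
    calc (k.factorial : ℝ) * ((1 / 2) ^ k * k) ≤ (k : ℝ) ^ k * ((1 / 2) ^ k * 2 ^ k) := by gcongr
      _ = (k : ℝ) ^ k := by rw [← mul_pow]; norm_num
  have h4 : (S - k * amax) ^ k ≤ (k : ℝ) ^ k * t := by
    calc (S - k * amax) ^ k ≤ (k.factorial : ℝ) * ((1 / 2) ^ k * ((k : ℝ) * t)) := h3
      _ = (k.factorial : ℝ) * ((1 / 2) ^ k * (k : ℝ)) * t := by ring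
      _ ≤ (k : ℝ) ^ k * t := mul_le_mul_of_nonneg_right hA ht0
  -- `k`-th roots
  have hSk : 0 ≤ S - k * amax := by linarith
  have h5 : S - k * amax ≤ k * t ^ (1 / (k : ℝ)) := by
    have h := Real.rpow_le_rpow (pow_nonneg hSk k) h4 (by positivity : (0 : ℝ) ≤ 1 / (k : ℝ))
    rw [one_div, Real.pow_rpow_inv_natCast hSk hkne, Real.mul_rpow (by positivity) ht0,
      Real.pow_rpow_inv_natCast hk0.le hkne] at h
    rw [one_div]
    exact h
  nlinarith

/-! ### The three ranges of Lemma 3.7 -/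

/-- Sums of a non-negative function over a union. [folklore] -/
private theorem sum_union_le_add {s t : Finset ℕ} {f : ℕ → ℝ} (hf : ∀ p, 0 ≤ f p) :
    ∑ p ∈ s ∪ t, f p ≤ ∑ p ∈ s, f p + ∑ p ∈ t, f p := by
  classical
  rw [← Finset.sum_union_inter]
  have : 0 ≤ ∑ p ∈ s ∩ t, f p := Finset.sum_nonneg fun p _ => hf p
  linarith

/-- **Splitting the index set of Lemma 3.7**: `{p ≤ M} ⊆ {p ≤ m} ∪ {m < p ≤ D} ∪ {D < p ≤ M}` for any
`m, M` (for non-negative summands; used with `m ≤ D ≤ M`). [cite: BuiPrattZaharescu2023, §3 proof of Lemma 3.7 (the three ranges)] -/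
theorem sum_splitPrimes_Iic_le_three {ψ : DirichletCharacter ℂ D} {f : ℕ → ℝ} (hf : ∀ p, 0 ≤ f p)
    (m M : ℕ) :
    ∑ p ∈ splitPrimes ψ (Iic M), f p ≤
      ∑ p ∈ splitPrimes ψ (Iic m), f p + ∑ p ∈ splitPrimes ψ (Ioc m D), f p +
        ∑ p ∈ splitPrimes ψ (Ioc D M), f p := by
  classical
  have hsub : splitPrimes ψ (Iic M) ⊆
      splitPrimes ψ (Iic m) ∪ splitPrimes ψ (Ioc m D) ∪ splitPrimes ψ (Ioc D M) := by
    intro p hp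
    obtain ⟨hpM, hpr, hψ⟩ := mem_splitPrimes.mp hp
    rw [Finset.mem_Iic] at hpM
    rw [Finset.mem_union, Finset.mem_union, mem_splitPrimes, mem_splitPrimes, mem_splitPrimes,
      Finset.mem_Iic, Finset.mem_Ioc, Finset.mem_Ioc]
    by_cases h1 : p ≤ m
    · exact Or.inl (Or.inl ⟨h1, hpr, hψ⟩)
    · by_cases h2 : p ≤ D
      · exact Or.inl (Or.inr ⟨⟨by omega, h2⟩, hpr, hψ⟩)
      · exact Or.inr ⟨⟨by omega, hpM⟩, hpr, hψ⟩
  calc ∑ p ∈ splitPrimes ψ (Iic M), f p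
      ≤ ∑ p ∈ splitPrimes ψ (Iic m) ∪ splitPrimes ψ (Ioc m D) ∪ splitPrimes ψ (Ioc D M), f p :=
        Finset.sum_le_sum_of_subset_of_nonneg hsub fun p _ _ => hf p
    _ ≤ ∑ p ∈ splitPrimes ψ (Iic m) ∪ splitPrimes ψ (Ioc m D), f p +
          ∑ p ∈ splitPrimes ψ (Ioc D M), f p := sum_union_le_add hf
    _ ≤ _ := by
        have := sum_union_le_add (s := splitPrimes ψ (Iic m)) (t := splitPrimes ψ (Ioc m D)) hf
        linarith

/-- **The range `p ≤ y`** (trivial bound, Mertens): `∑_{p ≤ m, ψ(p)=1} (log p)/p ≤ log m + log 4`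
(tree: `MertensBound.sum_log_div_prime_le`).
[cite: BuiPrattZaharescu2023, §3 proof of Lemma 3.7 ("For the first sum we use the trivial bound")] -/
theorem sum_log_div_splitPrimes_Iic_le (ψ : DirichletCharacter ℂ D) (m : ℕ) :
    ∑ p ∈ splitPrimes ψ (Iic m), Real.log p / p ≤ Real.log m + Real.log 4 := by
  classical
  refine le_trans ?_ (MertensBound.sum_log_div_prime_le m)
  apply Finset.sum_le_sum_of_subset_of_nonneg
  · intro p hp
    obtain ⟨hpm, hp, _⟩ := mem_splitPrimes.mp hp
    exact Nat.mem_primesLE.mpr ⟨Finset.mem_Iic.mp hpm, hp⟩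
  · intro p hp _
    have h := (Nat.mem_primesLE.mp hp).2
    exact div_nonneg (Real.log_nonneg (by exact_mod_cast h.one_lt.le)) (Nat.cast_nonneg _)

/-- **The range `D < p ≤ x`**: `∑_{D < p ≤ x, ψ(p)=1} (log p)/p ≤ log x · (2 L(1,ψ) log x)^{1/2}`
(from `sq_sum_inv_splitPrimes_le'`; the source: "`= ∑_{p ≤ D} … + O(L(1,ψ)^{1/2}(log x)^{3/2})`").
[cite: BuiPrattZaharescu2023, §3 proof of Lemma 3.7 (second display)] -/
theorem sum_log_div_splitPrimes_Ioc_le [NeZero D] {ψ : DirichletCharacter ℂ D}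
    (hprim : ψ.IsPrimitive) (hquad : ψ.IsQuadratic) (hT : LacunarityThreshold D) {x : ℝ}
    (hx : (D : ℝ) ≤ x) :
    ∑ p ∈ splitPrimes ψ (Ioc D ⌊x⌋₊), Real.log p / p ≤
      Real.log x * Real.sqrt (2 * (‖ψ.LFunction 1‖ * Real.log x)) := by
  classical
  have hD := four_le_of_lacunarityThreshold hT
  have hD0 : (0 : ℝ) < D := by exact_mod_cast (show 0 < D by omega)
  have hD1 : (1 : ℝ) ≤ D := by exact_mod_cast (show 1 ≤ D by omega)
  have hx0 : 0 < x := lt_of_lt_of_le hD0 hx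
  have hsq := sq_sum_inv_splitPrimes_le' hprim hquad hT hx
  set s := ∑ p ∈ splitPrimes ψ (Ioc D ⌊x⌋₊), (1 : ℝ) / p with hs
  have hs0 : 0 ≤ s := Finset.sum_nonneg fun p _ => by positivity
  have hlogx : 0 ≤ Real.log x := Real.log_nonneg (le_trans hD1 hx)
  have hs1 : s ≤ Real.sqrt (2 * (‖ψ.LFunction 1‖ * Real.log x)) :=
    (Real.le_sqrt hs0 (by positivity)).mpr hsq
  calc ∑ p ∈ splitPrimes ψ (Ioc D ⌊x⌋₊), Real.log p / p
      ≤ ∑ p ∈ splitPrimes ψ (Ioc D ⌊x⌋₊), Real.log x * ((1 : ℝ) / p) := by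
        apply Finset.sum_le_sum
        intro p hp
        obtain ⟨hpI, hpr, _⟩ := mem_splitPrimes.mp hp
        have hp0 : (0 : ℝ) < p := by exact_mod_cast hpr.pos
        have hpx : (p : ℝ) ≤ x :=
          le_trans (by exact_mod_cast (Finset.mem_Ioc.mp hpI).2) (Nat.floor_le hx0.le)
        rw [mul_one_div]
        exact div_le_div_of_nonneg_right (Real.log_le_log hp0 hpx) hp0.le
    _ = Real.log x * s := by rw [hs, Finset.mul_sum]
    _ ≤ Real.log x * Real.sqrt (2 * (‖ψ.LFunction 1‖ * Real.log x)) :=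
        mul_le_mul_of_nonneg_left hs1 hlogx

/-! ### Two numerical facts -/

/-- `log z ≤ z/e` for `z > 0` (the tangent line of `log` at `z = e`). [folklore] -/
private theorem log_le_div_exp_one {z : ℝ} (hz : 0 < z) : Real.log z ≤ z / Real.exp 1 := by
  have h := Real.log_le_sub_one_of_pos (show 0 < z / Real.exp 1 by positivity)
  rw [Real.log_div hz.ne' (Real.exp_pos 1).ne', Real.log_exp] at h
  linarith

/-- `(log ℓ)² ≤ ℓ` for `ℓ > 0` with `log ℓ ≥ 0` (`log ℓ = 2 log √ℓ ≤ 2√ℓ/e ≤ √ℓ`). [folklore] -/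
private theorem log_sq_le_self {ℓ : ℝ} (hℓ : 0 < ℓ) (hlog : 0 ≤ Real.log ℓ) :
    Real.log ℓ ^ 2 ≤ ℓ := by
  have hs : 0 < Real.sqrt ℓ := Real.sqrt_pos.mpr hℓ
  have h1 : Real.log ℓ = 2 * Real.log (Real.sqrt ℓ) := by
    conv_lhs => rw [← Real.sq_sqrt hℓ.le]
    rw [Real.log_pow]; norm_num
  have h2 : Real.log (Real.sqrt ℓ) ≤ Real.sqrt ℓ / Real.exp 1 := log_le_div_exp_one hs
  have he : 2 ≤ Real.exp 1 := by linarith [Real.add_one_le_exp (1 : ℝ)]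
  have h3 : Real.log ℓ ≤ Real.sqrt ℓ := by
    rw [h1]
    have : 2 * (Real.sqrt ℓ / Real.exp 1) ≤ Real.sqrt ℓ := by
      rw [mul_div_assoc', div_le_iff₀ (Real.exp_pos 1)]
      nlinarith
    linarith
  calc Real.log ℓ ^ 2 ≤ Real.sqrt ℓ ^ 2 := pow_le_pow_left₀ hlog h3 2
    _ = ℓ := Real.sq_sqrt hℓ.le

/-- `e⁴ < 55`. [folklore] -/
private theorem exp_four_lt : Real.exp 4 < 55 := by
  have h : Real.exp 4 = Real.exp 1 ^ 4 := by
    rw [← Real.exp_nat_mul]; norm_num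
  rw [h]
  have h1 := Real.exp_one_lt_d9
  have h0 : 0 ≤ Real.exp 1 := (Real.exp_pos 1).le
  calc Real.exp 1 ^ 4 < (2.7182818286 : ℝ) ^ 4 := pow_lt_pow_left₀ h1 h0 (by norm_num)
    _ < 55 := by norm_num

end BPZ2024

set_option maxHeartbeats 800000 in
open BPZ2024 in
/-- **Bui–Pratt–Zaharescu 2024, Lemma 3.7 — PROVED** (discharge of the named fact
`buiPrattZaharescu2024_lemma37`, with `C = 115`, `c₀ = e^{−e}`, `D₀ = max(D₀(threshold), 5)`): for
`D ≥ D₀`, `ψ` real odd primitive mod `D` with `L(1,ψ) log D ≤ e^{−e}`, and `x ≥ D`,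
`∑_{p ≤ x, ψ(p)=1} (log p)/p ≤ 115·( (log log(1/t)/log(1/t))·log D + L(1,ψ)^{1/2}(log x)^{3/2} )`,
`t = L(1,ψ) log D`. Proof = the printed one (three ranges) with Friedlander–Iwaniec's Proposition 3.1
replaced by the in-file `k`-fold tensor power (`sum_inv_splitPrimes_mid_le`), `κ = 2/k`,
`k = ⌈ℓ/(2 log ℓ)⌉`, `ℓ = log(1/t)`. [cite: BuiPrattZaharescu2023, §3 Lemma 3.7 p. 10 l. 5–11 and its proof] -/
theorem buiPrattZaharescu2024_lemma37_holds : buiPrattZaharescu2024_lemma37 := by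
  classical
  obtain ⟨D₁, hD₁⟩ := BPZ2024.eventually_lacunarityThreshold
  refine ⟨115, by norm_num, Real.exp (-Real.exp 1), Real.exp_pos _, max D₁ 5, ?_⟩
  intro D _ hD ψ hprim hquad _hodd ht x hx
  have hT : LacunarityThreshold D := hD₁ D (le_trans (le_max_left _ _) hD)
  have hD5 : 5 ≤ D := le_trans (le_max_right _ _) hD
  have hD0 : (0 : ℝ) < D := by exact_mod_cast (show 0 < D by omega)
  have hD1 : (1 : ℝ) ≤ D := by exact_mod_cast (show 1 ≤ D by omega)
  have hsqD : 0 < Real.sqrt D := Real.sqrt_pos.mpr hD0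
  have hlogD0 : 0 ≤ Real.log D := Real.log_natCast_nonneg D
  have hlogD5 : 5 < Real.log D := by
    have hT' := hT
    unfold LacunarityThreshold at hT'
    have : 0 ≤ 6 * (1 + Real.log D) * (1 + 2 * Real.log D) / Real.sqrt D := by positivity
    linarith
  -- `L = L(1,ψ) ≥ 0.69/√D > 0`, `t = L log D ∈ (0, e^{-e}]`
  set L : ℝ := ‖ψ.LFunction 1‖ with hL
  have hLfloor : (69 / 100) / Real.sqrt D ≤ L := norm_LFunction_one_ge hprim hquad (by omega)
  have hL0 : 0 < L := lt_of_lt_of_le (by positivity) hLfloor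
  set t : ℝ := L * Real.log D with htdef
  have ht0 : 0 < t := by positivity
  have hte : t ≤ Real.exp (-Real.exp 1) := ht
  -- `ℓ = log(1/t) ≥ e`, `w = log ℓ ≥ 1`
  set ℓ : ℝ := Real.log (1 / t) with hℓ
  have hℓe : Real.exp 1 ≤ ℓ := by
    have h1 : Real.exp (Real.exp 1) ≤ 1 / t := by
      rw [le_one_div (Real.exp_pos _) ht0, one_div, ← Real.exp_neg]
      exact hte
    calc Real.exp 1 = Real.log (Real.exp (Real.exp 1)) := (Real.log_exp _).symm
      _ ≤ ℓ := Real.log_le_log (Real.exp_pos _) h1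
  have he2 : 2 ≤ Real.exp 1 := by linarith [Real.add_one_le_exp (1 : ℝ)]
  have hℓ2 : 2 ≤ ℓ := le_trans he2 hℓe
  have hℓ0 : 0 < ℓ := by linarith
  set w : ℝ := Real.log ℓ with hw
  have hw1 : 1 ≤ w := by
    calc (1 : ℝ) = Real.log (Real.exp 1) := (Real.log_exp 1).symm
      _ ≤ w := Real.log_le_log (Real.exp_pos 1) hℓe
  have hw0 : 0 < w := by linarith
  have hw2 : w ^ 2 ≤ ℓ := log_sq_le_self hℓ0 hw0.le
  -- (F0) `2ℓ ≤ log D` (since `t ≥ 1/√D`)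
  have hF0 : 2 * ℓ ≤ Real.log D := by
    have h1 : 1 / Real.sqrt D ≤ t := by
      calc 1 / Real.sqrt D ≤ (69 / 100) * 5 / Real.sqrt D := by
            rw [div_le_div_iff_of_pos_right hsqD]; norm_num
        _ = (69 / 100) / Real.sqrt D * 5 := by ring
        _ ≤ L * Real.log D := mul_le_mul hLfloor hlogD5.le (by norm_num) hL0.le
    have h2 : ℓ ≤ Real.log (Real.sqrt D) := by
      apply Real.log_le_log (by positivity)
      calc 1 / t ≤ 1 / (1 / Real.sqrt D) := one_div_le_one_div_of_le (by positivity) h1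
        _ = Real.sqrt D := one_div_one_div _
    rw [Real.log_sqrt hD0.le] at h2
    linarith
  -- `k = ⌈ℓ/(2w)⌉ ≥ 2`
  set k : ℕ := ⌈ℓ / (2 * w)⌉₊ with hkdef
  have hℓ2w : 1 < ℓ / (2 * w) := by
    rw [lt_div_iff₀ (by positivity), one_mul, hw]
    have h1 : Real.log (ℓ / 2) ≤ ℓ / 2 - 1 := Real.log_le_sub_one_of_pos (by positivity)
    rw [Real.log_div hℓ0.ne' two_ne_zero] at h1
    have h2 : Real.log 2 < 1 := by linarith [Real.log_two_lt_d9]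
    linarith
  have hk2 : 2 ≤ k := by
    have : 1 < k := Nat.lt_ceil.mpr (by exact_mod_cast hℓ2w)
    omega
  have hkge : ℓ / (2 * w) ≤ k := Nat.le_ceil _
  have hkle : (k : ℝ) ≤ ℓ / (2 * w) + 1 := (Nat.ceil_lt_add_one (by positivity)).le
  have hk0 : (0 : ℝ) < k := by exact_mod_cast (show 0 < k by omega)
  have hkne : (k : ℝ) ≠ 0 := hk0.ne'
  -- consequences: `2wk ≤ ℓ + 2w`, `w ≤ 2k`, `k ≤ ℓ/w`, `2/k ≤ 4w/ℓ`
  have hA1 : 2 * w * k ≤ ℓ + 2 * w := by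
    have := mul_le_mul_of_nonneg_left hkle (show 0 ≤ 2 * w by positivity)
    have e : 2 * w * (ℓ / (2 * w) + 1) = ℓ + 2 * w := by field_simp
    linarith
  have hA2 : w ≤ 2 * k := by
    have : w / 2 ≤ ℓ / (2 * w) := by
      rw [div_le_div_iff₀ (by norm_num) (by positivity)]
      nlinarith [hw2]
    linarith
  have hA3 : (k : ℝ) ≤ ℓ / w := by
    have e : ℓ / w = ℓ / (2 * w) + ℓ / (2 * w) := by field_simp; ring
    linarith [hℓ2w.le]
  have hA4 : 2 / (k : ℝ) ≤ 4 * w / ℓ := by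
    rw [div_le_div_iff₀ hk0 hℓ0]
    have := mul_le_mul_of_nonneg_left hkge (show 0 ≤ 4 * w by positivity)
    have e : 4 * w * (ℓ / (2 * w)) = 2 * ℓ := by field_simp; ring
    linarith
  -- `t^{1/k} ≤ e⁴/ℓ²`
  have hlogt : Real.log t = -ℓ := by rw [hℓ, one_div, Real.log_inv, neg_neg]
  have htk : t ^ (1 / (k : ℝ)) ≤ 55 / ℓ ^ 2 := by
    have hℓk : 2 * w - 4 ≤ ℓ / k := by
      rw [le_div_iff₀ hk0]
      have e : (2 * w - 4) * (k : ℝ) = 2 * w * k - 4 * k := by ring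
      rw [e]
      linarith
    rw [Real.rpow_def_of_pos ht0, hlogt]
    have hexp : Real.exp (-ℓ * (1 / (k : ℝ))) ≤ Real.exp (4 - 2 * w) := by
      apply Real.exp_le_exp.mpr
      have : -ℓ * (1 / (k : ℝ)) = -(ℓ / k) := by ring
      rw [this]; linarith
    refine hexp.trans ?_
    have hsplit : Real.exp (4 - 2 * w) = Real.exp 4 / ℓ ^ 2 := by
      rw [Real.exp_sub, hw, show 2 * Real.log ℓ = Real.log (ℓ ^ 2) by rw [Real.log_pow]; norm_num,
        Real.exp_log (by positivity)]
    rw [hsplit]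
    exact div_le_div_of_nonneg_right exp_four_lt.le (by positivity)
  -- `κ = 2/k`, `y = D^κ`, `m = min ⌊y⌋ D`
  set κ : ℝ := 2 / k with hκ
  have hκ0 : 0 ≤ κ := by positivity
  set y : ℝ := (D : ℝ) ^ κ with hy
  have hy0 : 0 < y := Real.rpow_pos_of_pos hD0 _
  set m : ℕ := min ⌊y⌋₊ D with hm
  have hmy : (m : ℝ) ≤ y := le_trans (by exact_mod_cast min_le_left _ _) (Nat.floor_le hy0.le)
  -- the decomposition
  have hf0 : ∀ p : ℕ, 0 ≤ Real.log p / p := fun p =>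
    div_nonneg (Real.log_natCast_nonneg p) (Nat.cast_nonneg p)
  have hdec := sum_splitPrimes_Iic_le_three (ψ := ψ) hf0 m ⌊x⌋₊
  -- (i) `p ≤ m`
  have hI : ∑ p ∈ splitPrimes ψ (Iic m), Real.log p / p ≤ 4 * w / ℓ * Real.log D + Real.log 4 := by
    refine (sum_log_div_splitPrimes_Iic_le ψ m).trans ?_
    have hlogm : Real.log m ≤ κ * Real.log D := by
      rcases Nat.eq_zero_or_pos m with h0 | hpos
      · rw [h0, Nat.cast_zero, Real.log_zero]; positivity
      · calc Real.log m ≤ Real.log y := Real.log_le_log (by exact_mod_cast hpos) hmy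
          _ = κ * Real.log D := by rw [hy, Real.log_rpow hD0]
    have : κ * Real.log D ≤ 4 * w / ℓ * Real.log D := mul_le_mul_of_nonneg_right hA4 hlogD0
    linarith
  -- (ii) `m < p ≤ D`
  have hII : ∑ p ∈ splitPrimes ψ (Ioc m D), Real.log p / p ≤ 110 * (w / ℓ * Real.log D) := by
    -- first `Σ log p/p ≤ log D · S`
    have hS1 : ∑ p ∈ splitPrimes ψ (Ioc m D), Real.log p / p ≤
        Real.log D * ∑ p ∈ splitPrimes ψ (Ioc m D), (1 : ℝ) / p := by
      rw [Finset.mul_sum]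
      apply Finset.sum_le_sum
      intro p hp
      obtain ⟨hpI, hpr, _⟩ := mem_splitPrimes.mp hp
      have hp0 : (0 : ℝ) < p := by exact_mod_cast hpr.pos
      have hpD : (p : ℝ) ≤ D := by exact_mod_cast (Finset.mem_Ioc.mp hpI).2
      rw [mul_one_div]
      exact div_le_div_of_nonneg_right (Real.log_le_log hp0 hpD) hp0.le
    refine hS1.trans ?_
    -- the sum of `1/p`
    have hS2 : ∑ p ∈ splitPrimes ψ (Ioc m D), (1 : ℝ) / p ≤ 2 * k * (55 / ℓ ^ 2) := by
      rcases lt_or_ge ⌊y⌋₊ D with hcase | hcase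
      · -- `m = ⌊y⌋`, `(m+1)^k > y^k = D²`
        have hmeq : m = ⌊y⌋₊ := min_eq_left hcase.le
        have hm1 : y < (m : ℝ) + 1 := by rw [hmeq]; exact Nat.lt_floor_add_one y
        have hyk : y ^ k = (D : ℝ) ^ 2 := by
          rw [hy, ← Real.rpow_natCast, ← Real.rpow_mul hD0.le, hκ, div_mul_cancel₀ _ hkne,
            Real.rpow_two]
        have hlow' : ((D : ℝ)) ^ 2 < ((m : ℝ) + 1) ^ k := by
          rw [← hyk]; exact pow_lt_pow_left₀ hm1 hy0.le (by omega)
        have hlow : D ^ 2 < (m + 1) ^ k := by exact_mod_cast hlow'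
        have h := sum_inv_splitPrimes_mid_le hprim hquad hT hk2 hlow
        -- `1/(m+1) ≤ 1/y = D^{-κ} ≤ t^{1/k}`
        have hmy' : 1 / ((m : ℝ) + 1) ≤ t ^ (1 / (k : ℝ)) := by
          have h1 : 1 / ((m : ℝ) + 1) ≤ 1 / y := one_div_le_one_div_of_le hy0 hm1.le
          have h2 : 1 / y ≤ t ^ (1 / (k : ℝ)) := by
            rw [hy, Real.rpow_def_of_pos hD0, Real.rpow_def_of_pos ht0, hlogt, one_div,
              ← Real.exp_neg]
            apply Real.exp_le_exp.mpr
            rw [hκ]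
            have e1 : -ℓ * (1 / (k : ℝ)) = -(ℓ / k) := by ring
            have e2 : -(Real.log D * (2 / (k : ℝ))) = -(2 * Real.log D / k) := by ring
            rw [e1, e2, neg_le_neg_iff, div_le_div_iff_of_pos_right hk0]
            linarith
          exact h1.trans h2
        calc ∑ p ∈ splitPrimes ψ (Ioc m D), (1 : ℝ) / p
            ≤ k * (1 / ((m : ℝ) + 1) + t ^ (1 / (k : ℝ))) := h
          _ ≤ k * (t ^ (1 / (k : ℝ)) + t ^ (1 / (k : ℝ))) := by gcongr
          _ = 2 * k * t ^ (1 / (k : ℝ)) := by ring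
          _ ≤ 2 * k * (55 / ℓ ^ 2) := by gcongr
      · -- `m = D`: the range is empty
        have hmeq : m = D := min_eq_right hcase
        rw [hmeq, Finset.Ioc_self]
        simp only [splitPrimes, Finset.filter_empty, Finset.sum_empty]
        positivity
    -- `log D · 2k·55/ℓ² ≤ 110 (w/ℓ) log D`
    have hS3 : 2 * (k : ℝ) * (55 / ℓ ^ 2) ≤ 110 * (w / ℓ) := by
      have h1 : 2 * (k : ℝ) * (55 / ℓ ^ 2) ≤ 2 * (ℓ / w) * (55 / ℓ ^ 2) := by gcongr
      have h2 : 2 * (ℓ / w) * (55 / ℓ ^ 2) = 110 / (ℓ * w) := by field_simp; ring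
      have h3 : 110 / (ℓ * w) ≤ 110 * (w / ℓ) := by
        rw [div_le_iff₀ (by positivity)]
        have e3 : 110 * (w / ℓ) * (ℓ * w) = 110 * w ^ 2 * (ℓ / ℓ) := by ring
        rw [e3, div_self hℓ0.ne', mul_one]
        have : 1 ≤ w ^ 2 := by nlinarith [hw1]
        linarith
      linarith
    calc Real.log D * ∑ p ∈ splitPrimes ψ (Ioc m D), (1 : ℝ) / p
        ≤ Real.log D * (2 * k * (55 / ℓ ^ 2)) := mul_le_mul_of_nonneg_left hS2 hlogD0
      _ ≤ Real.log D * (110 * (w / ℓ)) := mul_le_mul_of_nonneg_left hS3 hlogD0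
      _ = 110 * (w / ℓ * Real.log D) := by ring
  -- (iii) `D < p ≤ x`
  have hIII : ∑ p ∈ splitPrimes ψ (Ioc D ⌊x⌋₊), Real.log p / p ≤
      2 * (L ^ (1 / 2 : ℝ) * Real.log x ^ (3 / 2 : ℝ)) := by
    refine (sum_log_div_splitPrimes_Ioc_le hprim hquad hT hx).trans ?_
    have hlogx : 0 < Real.log x := by
      have hD1' : (1 : ℝ) < D := by exact_mod_cast (show 1 < D by omega)
      exact Real.log_pos (lt_of_lt_of_le hD1' hx)
    have hs2 : Real.sqrt 2 ≤ 2 := by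
      have h := Real.sqrt_le_sqrt (show (2 : ℝ) ≤ 2 ^ 2 by norm_num)
      rwa [Real.sqrt_sq (by norm_num : (0 : ℝ) ≤ 2)] at h
    have e1 : Real.sqrt (2 * (L * Real.log x)) =
        Real.sqrt 2 * (L ^ (1 / 2 : ℝ) * Real.sqrt (Real.log x)) := by
      rw [Real.sqrt_mul (by norm_num), Real.sqrt_mul hL0.le, Real.sqrt_eq_rpow L]
    have e2 : Real.log x ^ (3 / 2 : ℝ) = Real.log x * Real.sqrt (Real.log x) := by
      rw [Real.sqrt_eq_rpow, show (3 / 2 : ℝ) = 1 + 1 / 2 by norm_num, Real.rpow_add hlogx,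
        Real.rpow_one]
    rw [e1, e2]
    have hpos : 0 ≤ L ^ (1 / 2 : ℝ) * (Real.log x * Real.sqrt (Real.log x)) := by positivity
    calc Real.log x * (Real.sqrt 2 * (L ^ (1 / 2 : ℝ) * Real.sqrt (Real.log x)))
        = Real.sqrt 2 * (L ^ (1 / 2 : ℝ) * (Real.log x * Real.sqrt (Real.log x))) := by ring
      _ ≤ 2 * (L ^ (1 / 2 : ℝ) * (Real.log x * Real.sqrt (Real.log x))) :=
          mul_le_mul_of_nonneg_right hs2 hpos
  -- assembly
  have hwℓD : 2 * w ≤ w / ℓ * Real.log D := by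
    have : w / ℓ * (2 * ℓ) ≤ w / ℓ * Real.log D := mul_le_mul_of_nonneg_left hF0 (by positivity)
    have e : w / ℓ * (2 * ℓ) = 2 * w := by field_simp
    linarith
  have hlog4 : Real.log 4 ≤ (7 / 10) * (w / ℓ * Real.log D) := by
    have : Real.log 4 = 2 * Real.log 2 := by
      rw [show (4 : ℝ) = 2 ^ 2 by norm_num, Real.log_pow]; norm_num
    rw [this]
    linarith [Real.log_two_lt_d9]
  have hsecond : 0 ≤ L ^ (1 / 2 : ℝ) * Real.log x ^ (3 / 2 : ℝ) := by
    have : 0 ≤ Real.log x := Real.log_nonneg (le_trans hD1 hx)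
    positivity
  have h41 : 4 * w / ℓ * Real.log D = 4 * (w / ℓ * Real.log D) := by ring
  calc ∑ p ∈ splitPrimes ψ (Finset.Iic ⌊x⌋₊), Real.log p / p
      ≤ ∑ p ∈ splitPrimes ψ (Iic m), Real.log p / p + ∑ p ∈ splitPrimes ψ (Ioc m D), Real.log p / p +
          ∑ p ∈ splitPrimes ψ (Ioc D ⌊x⌋₊), Real.log p / p := hdec
    _ ≤ (4 * w / ℓ * Real.log D + Real.log 4) + 110 * (w / ℓ * Real.log D) +
          2 * (L ^ (1 / 2 : ℝ) * Real.log x ^ (3 / 2 : ℝ)) := add_le_add (add_le_add hI hII) hIII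
    _ ≤ 115 * (w / ℓ * Real.log D + L ^ (1 / 2 : ℝ) * Real.log x ^ (3 / 2 : ℝ)) := by
        rw [h41]; linarith


end Literature.NumberTheory.LFunctions
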